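import Mathlib
import Summits.ValiantsHypothesis.ValiantsHypothesis.Theses.BinomialElusive
import Summits.ValiantsHypothesis.ValiantsHypothesis.Theorems.BinomialElusiveNumericToPuiseux
import Summits.ValiantsHypothesis.ValiantsHypothesis.Theorems.BinomialElusiveNoShortRelations
import Summits.ValiantsHypothesis.ValiantsHypothesis.Theorems.BinomialElusiveBinomialCandidateExpoCongruence
import Summits.ValiantsHypothesis.ValiantsHypothesis.Theorems.BinomialElusiveBinomialCandidateExpoCongruenceDeg
import Summits.ValiantsHypothesis.ValiantsHypothesis.Theorems.BinomialElusiveBinomialCandidateLowDegreeVanishing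
import Summits.ValiantsHypothesis.ValiantsHypothesis.Theorems.BinomialElusiveBinomialCandidateJetReduction
import Summits.ValiantsHypothesis.ValiantsHypothesis.Theorems.BinomialElusiveBinomialCandidateCrossCap
import Summits.ValiantsHypothesis.ValiantsHypothesis.Theorems.BinomialElusiveBinomialCandidatePolarNoCommonZero
import Summits.ValiantsHypothesis.ValiantsHypothesis.Theorems.BinomialElusiveBinomialCandidateInfinityGlue
import Summits.ValiantsHypothesis.ValiantsHypothesis.Theorems.BinomialElusiveBinomialCandidateInfinityCommonZero
import Summits.ValiantsHypothesis.ValiantsHypothesis.Theorems.BinomialElusiveBinomialCandidateInfinityStepTwo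
import Summits.ValiantsHypothesis.ValiantsHypothesis.Theorems.BinomialElusiveBinomialCandidateInfinityStepTwoImproper
import Summits.ValiantsHypothesis.ValiantsHypothesis.Theorems.BinomialElusiveBinomialCandidatePolarStepTwo
import Summits.ValiantsHypothesis.ValiantsHypothesis.Theorems.BinomialElusiveBinomialCandidateExpoGrowth
import Summits.ValiantsHypothesis.ValiantsHypothesis.Theorems.BinomialElusiveBinomialCandidateShallowCorankOne
import Summits.ValiantsHypothesis.ValiantsHypothesis.Theorems.BinomialElusiveBinomialCandidateNondegenerateCorankTwo
import Summits.ValiantsHypothesis.ValiantsHypothesis.Theorems.BinomialElusiveBinomialCandidateAffineOrdersDependent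
import Summits.ValiantsHypothesis.ValiantsHypothesis.Theorems.BinomialElusiveBinomialCandidateInfinityStepTwoImproperMinors
import Summits.ValiantsHypothesis.ValiantsHypothesis.Theorems.BinomialElusiveBinomialCandidatePolarStepTwoMinors
import Summits.ValiantsHypothesis.ValiantsHypothesis.Theorems.BinomialElusiveBinomialCandidateInfinityIntegralRemainderOrders

/-!
# Skeleton v4 for crux `BinomialElusive.BinomialCandidate` (stmt-ValiantsHypothesis-7392), line `registered`
# (lead c2 reshape, 2026-08-17): the PLACE AT INFINITY of the curve enters the composition

Crux decl `Summit.ValiantsHypothesis.ValiantsHypothesis.Theses.BinomialElusive.BinomialCandidate` (X): for all large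
`m`, no quadratic `Γ : ℂ^{m-1} → ℂ^m` has image containing the binomial curve `x ↦ (x^{E(2i+1)} + x^{E(2i+2)})_i`,
`E(j) = Σ_{k ≤ h} (jM)^k`, `h = ⌊log₂ m⌋²`, `M = (2m+2)^{h+1}`.

## Why the reshape (v3 = `Lines/registered.lean` at sha ea0c132c…, stubs `stub_nonImmersiveIntegral` + `stub_polarPeeling` open)
Skeleton v3 works only at the place of the swallowed curve over `x = 0`: a containment gives a Laurent solution
`Γ(p(t)) = f(tᴺ)` there (`numericToPuiseux_proof`); polar solutions force a common zero of ALL quadratic parts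
(`polar_forces_commonZero`, p150597), integral immersive and cross-cap base points are impossible for the E-family
(stubs 1a/1b/1c landed), and what is left — deep integral base points, improper `Γ` — is as open as the sibling crux
PeelingLemma.  The input no cycle had used is the place over `x = ∞`, where EVERY solution is polar:

* (∞-0, `stub_infinityGlue`, closable) a containment also gives `N' ≥ 1` and Laurent `p'` with
  `Γ(p'(t)) = f(t^{-N'})`, i.e. `Γ_i(p') = t^{-N' a_i} + t^{-N' b_i}` — from `numericToPuiseux_proof` applied to the
  homogenised map `(u, y) ↦ (2u², u²Γ(y/u))` and the curve `x ↦ (2x^{2c}, x^{2c-a_i} + x^{2c-b_i})`;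
* (∞-1, `stub_infinityCommonZero`, closable) with `μ < 0` the least order of `p'` and `z = p'_μ ≠ 0`, the `t^{2μ}`
  coefficient of `Γ_i(p')` is `B_i(z)` while the target starts at `t^{-N' b_i}`: so `2μ ≤ -N' b_i` and
  `B_i(z) = 0 ∨ 2μ = -N' b_i` for every `i`; as `b` is injective, the quadratic parts of ALL BUT AT MOST ONE `Γ_i`
  vanish at `z` — X holds for GENERIC `Γ` (any `m-1` of the `m` quadratic parts have only the trivial common zero:
  the complement of a resultant hypersurface), and every other `Γ` is near-ruled: `Γ_i = y₁A_i(y') + G_i(y')` for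
  `i ≠ τ` in coordinates with `z = e₁`;
* (∞-2, `stub_infinityStepTwo`, closable) in the branch `2μ = -N' b_τ` (so `B_τ(z) ≠ 0`, `τ` = the top exponent or
  not), write `p' = Λ z + r` with `Λ` of order `μ` and `r` of order `μ' > μ`: if `μ' ≥ 0` every `Γ_i(p')`, `i ≠ τ`,
  has order `≥ μ`, i.e. `2 b_i ≤ b_τ` for all `i ≠ τ` — impossible for the E-family (`2E(2m-2) > E(2m)`,
  `stub_expoGrowth`); if `μ' < 0` the `t^{μ+μ'}` coefficient of `Γ_i(p')` is `2B_i(z, z')` (`z' = r_{μ'} ∉ ℂz`) and the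
  target contributes only when `N' b_i = -(μ+μ')`, at most once (`i₁`): the polar bilinear forms `B_i(z, ·)`,
  `i ∉ {τ, i₁}`, all kill a second direction `z'`;
* (∞-2', `stub_infinityStepTwoImproper`, closable) in the other branch (`B_i(z) = 0` for ALL `i`) the same decomposition
  gives: an isotropic second direction `z'` for all but at most one `i`, or an integral `r` with value `w` and
  `dΓ_i(w)·z = 0` for all but at most one `i` (the target's `t^{μ}` / `t^{μ+μ'}` coefficient is `1` at most once);
* (0-polar-2, `stub_polarStepTwo`, closable) the same decomposition at a pole over `x = 0` (targets integral): either
  `r` has a pole and `B_i(z, z') = 0` for ALL `i` (isotropic 2-flag), or `r` is integral with value `w` and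
  `dΓ(w)·z = L(z) + 2B(z, w) = 0`, i.e. together with `B(z) = 0`: `Γ` contracts the affine line `w + ℂz` to a point.

The two open stubs are re-registered WITH these structures as hypotheses: `stub_integralDeep` (v3's
`stub_nonImmersiveIntegral` + the structure at infinity) and `stub_polarDeep` (v3's `stub_polarPeeling` + common zero +
the step-2 dichotomy + the structure at infinity).  They remain general-data statements with conclusion "short relation"
(the sibling crux's currency); every corner landed so far applies verbatim.

## Shape
* `Stmt.stub_…` — the stub statements as precise `Prop`s; `stub_…` — the same as theorems (the REGISTERED stubs carry the
  only `sorry`s; landed ones are linked to their Theorems decl); `BinomialCandidate_of` — composition, real proof;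
  `BinomialCandidate_proof` ties them.
Hardest stub: `stub_integralDeep` (deep base points; lead).  Closable now: `stub_infinityGlue` (M), `stub_infinityCommonZero`
(S/M), `stub_infinityStepTwo` (M), `stub_infinityStepTwoImproper` (M), `stub_polarStepTwo` (M), `stub_expoGrowth` (S).
**Disproof used.** None exists (no `Disproof.lean` for this crux at 2026-08-17T11:40Z); Negative/BinomialCandidateSmallLevels
(p143507: m₀ ≥ 4 for X) is consistent with every stub.

## v7 (lead c3, 2026-08-17): the dimension count at infinity
In the improper branch at the place over `x = ∞` (`B_i(z) = 0` for ALL `i`), write `p = Λ z + r`.  If the remainder `r` is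
INTEGRAL then `Γ_i(p) = Γ_i(r) + Λ · A_i(r)` with `A_i := Σ_j z_j ∂_jΓ_i` of degree `≤ 1` and invariant under translation by
`z` (`Σ_k z_k ∂_kA_i = 2B_i(z) = 0`); the target is purely polar and `Γ_i(r)` is integral, so `ord_t A_i(r(t)) = -N b_i - μ`:
`m` PAIRWISE DISTINCT integers.  But `m` such affine functions on `ℂ^s` live in a space of dimension `s < m`, hence satisfy a
nontrivial relation `Σ d_i A_i = 0`, and evaluating it along `r` the summand of least order survives — contradiction.  So the
improper branch always carries a SECOND POLE DIRECTION `z' ∉ ℂz` with `B_i(z, z') = 0` off one index, and the structure at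
infinity handed to the deep stubs loses its third disjunct (new closable stubs `stub_affineOrdersDependent`,
`stub_infinityIntegralRemainderOrders`, `stub_infinityStepTwoImproperMinors`; and `stub_polarStepTwoMinors` records the integral
remainder at a pole over `x = 0` in the same currency for the polar deep stub).
-/

namespace Summit.ValiantsHypothesis.ValiantsHypothesis.Cruxes.BinomialCandidate.Birth

open scoped BigOperators
open Summit.ValiantsHypothesis.ValiantsHypothesis.Theses.BinomialElusive
open Summit.ValiantsHypothesis.ValiantsHypothesis.Theorems.BinomialElusiveRazTransfer (expo)

set_option linter.dupNamespace false

/-! ## Stub statements — landed in cycle 1 (kept for the composition) -/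

/-- STUB 1a — JET REDUCTION AT AN IMMERSIVE INTEGRAL BASE POINT (LANDED p155296). -/
def Stmt.stub_jetReduction : Prop :=
  ∀ m ≥ 1, ∀ (a b : Fin m → ℕ) (Γ : Fin m → MvPolynomial (Fin (m - 1)) ℂ) (N : ℕ)
    (p : Fin (m - 1) → LaurentSeries ℂ), (∀ i, (Γ i).totalDegree ≤ 2) → 0 < N →
    (∀ j, 0 ≤ (p j).order) →
    LinearIndependent ℂ (fun j : Fin (m - 1) => fun i : Fin m =>
      MvPolynomial.eval (fun l => (p l).coeff 0) (MvPolynomial.pderiv j (Γ i))) →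
    (∀ i, 1 ≤ a i ∧ 1 ≤ b i) →
    (∀ i, MvPolynomial.aeval p (Γ i) =
      HahnSeries.single ((N * a i : ℕ) : ℤ) (1 : ℂ) + HahnSeries.single ((N * b i : ℕ) : ℤ) (1 : ℂ)) →
    ∃ (i₀ : Fin m) (ψ : MvPolynomial (Fin m) ℂ) (G : ℤ),
      (∀ d ∈ ψ.support, d i₀ = 0) ∧ MvPolynomial.constantCoeff ψ = 0 ∧
      (∀ i, 2 * ((N * a i : ℕ) : ℤ) < G ∧ 2 * ((N * b i : ℕ) : ℤ) < G) ∧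
      (∀ g < G, (MvPolynomial.aeval (fun i : Fin m => (HahnSeries.single ((N * a i : ℕ) : ℤ) (1 : ℂ) +
          HahnSeries.single ((N * b i : ℕ) : ℤ) (1 : ℂ) : LaurentSeries ℂ)) ψ).coeff g =
        (HahnSeries.single ((N * a i₀ : ℕ) : ℤ) (1 : ℂ) +
          HahnSeries.single ((N * b i₀ : ℕ) : ℤ) (1 : ℂ) : LaurentSeries ℂ).coeff g) ∧
      ((∀ d : Fin m →₀ ℕ, (d.sum fun _ e => e) ≤ 2 → MvPolynomial.coeff d ψ = 0) → False)

/-- STUB 1b — LOW-DEGREE VANISHING (LANDED p151884). -/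
def Stmt.stub_lowDegreeVanishing : Prop :=
  ∀ (m : ℕ) (a b : Fin m → ℕ) (N : ℕ), 0 < N →
    (∀ u v : Fin m → ℤ, ∑ i, (|u i| + |v i|) ≤ 4 → ∑ i, (u i * (a i : ℤ) + v i * (b i : ℤ)) = 0 → (u, v) = 0) →
    (∃ M' : ℕ, (∀ i, a i % M' = 1 ∧ b i % M' = 1) ∧
      (∀ i j, 2 * a i < M' * a j ∧ 2 * a i < M' * b j ∧ 2 * b i < M' * a j ∧ 2 * b i < M' * b j)) →
    ∀ (i₀ : Fin m) (ψ : MvPolynomial (Fin m) ℂ) (G : ℤ),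
      (∀ d ∈ ψ.support, d i₀ = 0) → MvPolynomial.constantCoeff ψ = 0 →
      (∀ i, 2 * ((N * a i : ℕ) : ℤ) < G ∧ 2 * ((N * b i : ℕ) : ℤ) < G) →
      (∀ g < G, (MvPolynomial.aeval (fun i : Fin m => (HahnSeries.single ((N * a i : ℕ) : ℤ) (1 : ℂ) +
          HahnSeries.single ((N * b i : ℕ) : ℤ) (1 : ℂ) : LaurentSeries ℂ)) ψ).coeff g =
        (HahnSeries.single ((N * a i₀ : ℕ) : ℤ) (1 : ℂ) +
          HahnSeries.single ((N * b i₀ : ℕ) : ℤ) (1 : ℂ) : LaurentSeries ℂ).coeff g) →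
      ∀ d : Fin m →₀ ℕ, (d.sum fun _ e => e) ≤ 2 → MvPolynomial.coeff d ψ = 0

/-- STUB 1c — CROSS-CAP POINTS ARE IMPOSSIBLE (LANDED p155996). -/
def Stmt.stub_crossCap : Prop :=
  ∀ m ≥ 2, ∀ (a b : Fin m → ℕ) (Γ : Fin m → MvPolynomial (Fin (m - 1)) ℂ) (N : ℕ)
    (p : Fin (m - 1) → LaurentSeries ℂ), (∀ i, (Γ i).totalDegree ≤ 2) → 0 < N →
    (∀ j, 0 ≤ (p j).order) →
    (∀ i, 1 ≤ a i ∧ 1 ≤ b i) →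
    (∀ u v : Fin m → ℤ, ∑ i, (|u i| + |v i|) ≤ 4 → ∑ i, (u i * (a i : ℤ) + v i * (b i : ℤ)) = 0 → (u, v) = 0) →
    (∃ M' : ℕ, (∀ i, a i % M' = 1 ∧ b i % M' = 1) ∧
      (∀ i j, 2 * a i < M' * a j ∧ 2 * a i < M' * b j ∧ 2 * b i < M' * a j ∧ 2 * b i < M' * b j)) →
    ∀ κ : Fin (m - 1) → ℂ, κ ≠ 0 →
      (∀ i, ∑ j, κ j * MvPolynomial.eval (fun l => (p l).coeff 0) (MvPolynomial.pderiv j (Γ i)) = 0) →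
      (∀ κ' : Fin (m - 1) → ℂ,
        (∀ i, ∑ j, κ' j * MvPolynomial.eval (fun l => (p l).coeff 0) (MvPolynomial.pderiv j (Γ i)) = 0) →
        ∃ μ : ℂ, κ' = μ • κ) →
      (¬ ∃ v : Fin (m - 1) → ℂ, ∀ i, MvPolynomial.eval κ (MvPolynomial.homogeneousComponent 2 (Γ i)) =
        ∑ j, v j * MvPolynomial.eval (fun l => (p l).coeff 0) (MvPolynomial.pderiv j (Γ i))) →
      (∀ i, MvPolynomial.aeval p (Γ i) =
        HahnSeries.single ((N * a i : ℕ) : ℤ) (1 : ℂ) + HahnSeries.single ((N * b i : ℕ) : ℤ) (1 : ℂ)) →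
      False

/-- STUB 4 — CONGRUENCE ARITHMETIC OF THE E-FAMILY (LANDED p151550). -/
def Stmt.stub_expoCongruence : Prop :=
  ∃ m₀ : ℕ, ∀ m ≥ m₀, ∀ j j' : ℕ, 1 ≤ j → j ≤ 2 * m → 1 ≤ j' → j' ≤ 2 * m →
    (∑ k ∈ Finset.range (Nat.log 2 m ^ 2 + 1), (j * (2 * m + 2) ^ (Nat.log 2 m ^ 2 + 1)) ^ k) %
        (2 * m + 2) ^ (Nat.log 2 m ^ 2 + 1) = 1 ∧
      2 * (∑ k ∈ Finset.range (Nat.log 2 m ^ 2 + 1), (j * (2 * m + 2) ^ (Nat.log 2 m ^ 2 + 1)) ^ k) <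
        (2 * m + 2) ^ (Nat.log 2 m ^ 2 + 1) *
          (∑ k ∈ Finset.range (Nat.log 2 m ^ 2 + 1), (j' * (2 * m + 2) ^ (Nat.log 2 m ^ 2 + 1)) ^ k)

/-! ## Stub statements — new in v4 (the place at infinity; closable) -/

/-- STUB ∞-0 — LAURENT SOLUTION AT THE PLACE AT INFINITY (closable, size M).  If the binomial curve
`x ↦ (x^{a_i} + x^{b_i})_i` lies in the image of a quadratic map `Γ : ℂ^s → ℂ^m`, then for some `N ≥ 1` there are
Laurent series `p ∈ ℂ((t))^s` with `Γ(p) = (t^{-N a_i} + t^{-N b_i})_i` (the expansion of a dominating curve at a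
place over `x = ∞`, local parameter `t` with `x = t^{-N}`).  Proof route: apply `numericToPuiseux_proof` (any
polynomial map, any `s`) to the homogenised map `Γ' = (2u², u²Γ_1(y/u), …, u²Γ_m(y/u)) : ℂ^{s+1} → ℂ^{m+1}` (each
`u²Γ_i(y/u) = Σ_d coeff_d(Γ_i) u^{2-|d|} y^d`, a polynomial as `totalDegree Γ_i ≤ 2`) and the binomial curve
`x ↦ (x^{2c} + x^{2c}, (x^{2c-a_i} + x^{2c-b_i})_i)` with `2c > max(a, b)`: containment holds (at `x ≠ 0` take
`u = x^c`, `Y = u·y` with `Γ(y) = f(1/x)`; at `x = 0` take `0`); the Laurent solution `(P_u, P_y)` has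
`2P_u² = 2t^{2cN}`, so `P_u = ± t^{cN}`, and `p := P_y / P_u` satisfies `Γ_i(p) = P_u^{-2}·(u²Γ_i(y/u))(P) =
t^{-2cN}(t^{N(2c-a_i)} + t^{N(2c-b_i)})`. -/
def Stmt.stub_infinityGlue : Prop :=
  ∀ (m s : ℕ) (a b : Fin m → ℕ) (Γ : Fin m → MvPolynomial (Fin s) ℂ), 0 < m →
    (∀ i, (Γ i).totalDegree ≤ 2) →
    Set.range (fun x : ℂ => fun i : Fin m => x ^ a i + x ^ b i) ⊆
      Set.range (fun y : Fin s → ℂ => fun i : Fin m => MvPolynomial.eval y (Γ i)) →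
    ∃ (N : ℕ) (p : Fin s → LaurentSeries ℂ), 0 < N ∧ ∀ i, MvPolynomial.aeval p (Γ i) =
      HahnSeries.single (-((N * a i : ℕ) : ℤ)) (1 : ℂ) + HahnSeries.single (-((N * b i : ℕ) : ℤ)) (1 : ℂ)

/-- STUB ∞-1 — FIRST PEELING STEP AT INFINITY (closable, size S/M).  A Laurent solution at infinity
(`a_i < b_i`, so the target `Γ_i(p)` has order exactly `-N b_i < 0`) has a pole; with `μ < 0` the least order among the
`p_j` and `z = (p_j[t^μ])_j ≠ 0`, every `Γ_i(p)` has no coefficients below `2μ` and its `t^{2μ}` coefficient is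
`B_i(z)`, `B_i = homogeneousComponent 2 (Γ i)` (lowest-order calculus of `PolarPeeling.coeff_prod_pow_eq`, as in
`polar_forces_commonZero`).  Comparing with the target: `2μ ≤ -N b_i`, and `B_i(z) = 0` unless `2μ = -N b_i`. -/
def Stmt.stub_infinityCommonZero : Prop :=
  ∀ (m s : ℕ) (a b : Fin m → ℕ) (Γ : Fin m → MvPolynomial (Fin s) ℂ) (N : ℕ) (p : Fin s → LaurentSeries ℂ),
    0 < m → (∀ i, (Γ i).totalDegree ≤ 2) → 0 < N → (∀ i, a i < b i) →
    (∀ i, MvPolynomial.aeval p (Γ i) =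
      HahnSeries.single (-((N * a i : ℕ) : ℤ)) (1 : ℂ) + HahnSeries.single (-((N * b i : ℕ) : ℤ)) (1 : ℂ)) →
    ∃ μ : ℤ, μ < 0 ∧ (∀ j, ∀ g < μ, (p j).coeff g = 0) ∧ (fun j => (p j).coeff μ) ≠ 0 ∧
      ∀ i, 2 * μ ≤ -((N * b i : ℕ) : ℤ) ∧
        (MvPolynomial.eval (fun j => (p j).coeff μ) (MvPolynomial.homogeneousComponent 2 (Γ i)) = 0 ∨
          2 * μ = -((N * b i : ℕ) : ℤ))

/-- STUB ∞-2 — SECOND PEELING STEP AT INFINITY, branch `2μ = -N b_τ` (closable, size M).  Data as in ∞-1 with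
`z = p_μ ≠ 0`, an index `τ` with `2μ = -N b_τ`, `B_i(z) = 0` for `i ≠ τ`, `b` injective, and ONE index `i ≠ τ` with
`b_τ < 2 b_i`.  Pick `j₀` with `z_{j₀} ≠ 0`, `Λ := p_{j₀}/z_{j₀}` (order `μ`, leading coefficient `1`),
`r := p - Λ z` (so `r_μ = 0`; let `μ'` be its least order, `z' := r_{μ'}`, `z'_{j₀} = 0`).  For `i ≠ τ`,
`Γ_i(p) = c_i + Λ L_i(z) + L_i(r) + Λ·(Σ_j r_j ∂_jB_i(z)) + B_i(r)` (`B_i(z) = 0`).  If `μ' ≥ 0` (or `r = 0`) this has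
order `≥ μ`, so `-N b_i ≥ μ = -N b_τ/2` for all `i ≠ τ`, contradicting the last hypothesis.  If `μ' < 0` its `t^{μ+μ'}`
coefficient is `Σ_j z'_j ∂_jB_i(z)` (all other terms have order `> μ + μ'`), while the target's is `[N b_i = -(μ+μ')]`
(`-N a_i = μ+μ' ≤ -N b_i` is excluded by `a_i < b_i`); injectivity of `b` leaves at most one exceptional index `i₁`. -/
def Stmt.stub_infinityStepTwo : Prop :=
  ∀ (m s : ℕ) (a b : Fin m → ℕ) (Γ : Fin m → MvPolynomial (Fin s) ℂ) (N : ℕ) (p : Fin s → LaurentSeries ℂ)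
    (μ : ℤ) (τ : Fin m),
    (∀ i, (Γ i).totalDegree ≤ 2) → 0 < N → (∀ i, a i < b i) → Function.Injective b →
    (∀ i, MvPolynomial.aeval p (Γ i) =
      HahnSeries.single (-((N * a i : ℕ) : ℤ)) (1 : ℂ) + HahnSeries.single (-((N * b i : ℕ) : ℤ)) (1 : ℂ)) →
    μ < 0 → (∀ j, ∀ g < μ, (p j).coeff g = 0) → (fun j => (p j).coeff μ) ≠ 0 →
    2 * μ = -((N * b τ : ℕ) : ℤ) →
    (∀ i, i ≠ τ → MvPolynomial.eval (fun j => (p j).coeff μ) (MvPolynomial.homogeneousComponent 2 (Γ i)) = 0) →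
    (∃ i, i ≠ τ ∧ b τ < 2 * b i) →
    ∃ z' : Fin s → ℂ, (∀ c : ℂ, z' ≠ c • (fun j => (p j).coeff μ)) ∧ ∃ i₁ : Fin m, ∀ i, i ≠ τ → i ≠ i₁ →
      ∑ j, z' j * MvPolynomial.eval (fun l => (p l).coeff μ)
        (MvPolynomial.pderiv j (MvPolynomial.homogeneousComponent 2 (Γ i))) = 0

/-- STUB ∞-2' — SECOND PEELING STEP AT INFINITY, improper branch (closable, size M; `0 < m` added in v4.2 — the
conclusion needs an index, wave-1 worker's `stub-misstated` at `m = 0`).  Data as in ∞-1 with `z = p_μ ≠ 0`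
and `B_i(z) = 0` for ALL `i` (no index realises `2μ = -N b_i`), `b` injective, `a < b`.  Same decomposition
`p = Λ z + r` as in ∞-2.  If `r` has least order `μ' < 0`, the `t^{μ+μ'}` coefficient of `Γ_i(p)` is `Σ_j z'_j ∂_jB_i(z)`
and the target's is `[N b_i = -(μ+μ')]`: the polar forms kill `z' ∉ ℂz` for all but at most one index.  Otherwise `r` is
integral with value `w` and the `t^{μ}` coefficient of `Γ_i(p)` is `L_i(z) + Σ_j w_j ∂_jB_i(z) = Σ_j z_j (∂_jΓ_i)(w)`,
while the target's is `[N b_i = -μ]`: `dΓ_i(w)·z = 0` for all but at most one index (a line `w + ℂz` contracted by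
all but one coordinate). -/
def Stmt.stub_infinityStepTwoImproper : Prop :=
  ∀ (m s : ℕ) (a b : Fin m → ℕ) (Γ : Fin m → MvPolynomial (Fin s) ℂ) (N : ℕ) (p : Fin s → LaurentSeries ℂ)
    (μ : ℤ), 0 < m → (∀ i, (Γ i).totalDegree ≤ 2) → 0 < N → (∀ i, a i < b i) → Function.Injective b →
    (∀ i, MvPolynomial.aeval p (Γ i) =
      HahnSeries.single (-((N * a i : ℕ) : ℤ)) (1 : ℂ) + HahnSeries.single (-((N * b i : ℕ) : ℤ)) (1 : ℂ)) →
    μ < 0 → (∀ j, ∀ g < μ, (p j).coeff g = 0) → (fun j => (p j).coeff μ) ≠ 0 →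
    (∀ i, MvPolynomial.eval (fun j => (p j).coeff μ) (MvPolynomial.homogeneousComponent 2 (Γ i)) = 0) →
    (∃ z' : Fin s → ℂ, (∀ c : ℂ, z' ≠ c • (fun j => (p j).coeff μ)) ∧ ∃ i₁ : Fin m, ∀ i, i ≠ i₁ →
        ∑ j, z' j * MvPolynomial.eval (fun l => (p l).coeff μ)
          (MvPolynomial.pderiv j (MvPolynomial.homogeneousComponent 2 (Γ i))) = 0) ∨
    (∃ w : Fin s → ℂ, ∃ i₁ : Fin m, ∀ i, i ≠ i₁ →
        ∑ j, (p j).coeff μ * MvPolynomial.eval w (MvPolynomial.pderiv j (Γ i)) = 0)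

/-- STUB 0-polar-2 — SECOND PEELING STEP AT A POLE OVER `x = 0` (closable, size M; any data).  A Laurent solution of
`Γ(p) = (t^{N a_i} + t^{N b_i})_i` with least order `μ < 0`, `z = p_μ ≠ 0` and (first step, `polar_forces_commonZero`)
`B_i(z) = 0` for all `i`.  Decompose `p = Λ z + r` as in ∞-2.  If `r` has least order `μ' < 0`, the `t^{μ+μ'}`
coefficient of `Γ_i(p)` is `Σ_j z'_j ∂_jB_i(z)` and the target has no negative coefficients: an isotropic second
direction `z' ∉ ℂz` for ALL `i`.  Otherwise `r` is integral with value `w = r(0)` and the `t^{μ}` coefficient of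
`Γ_i(p)` is `L_i(z) + Σ_j w_j ∂_jB_i(z) = Σ_j z_j (∂_jΓ_i)(w)` (symmetry of the polarisation), which must vanish:
`dΓ(w)·z = 0`, so with `B(z) = 0` the affine line `w + ℂz` is contracted by `Γ` to a point. -/
def Stmt.stub_polarStepTwo : Prop :=
  ∀ (m s : ℕ) (a b : Fin m → ℕ) (Γ : Fin m → MvPolynomial (Fin s) ℂ) (N : ℕ) (p : Fin s → LaurentSeries ℂ)
    (μ : ℤ), (∀ i, (Γ i).totalDegree ≤ 2) → 0 < N →
    (∀ i, MvPolynomial.aeval p (Γ i) =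
      HahnSeries.single ((N * a i : ℕ) : ℤ) (1 : ℂ) + HahnSeries.single ((N * b i : ℕ) : ℤ) (1 : ℂ)) →
    μ < 0 → (∀ j, ∀ g < μ, (p j).coeff g = 0) → (fun j => (p j).coeff μ) ≠ 0 →
    (∀ i, MvPolynomial.eval (fun j => (p j).coeff μ) (MvPolynomial.homogeneousComponent 2 (Γ i)) = 0) →
    (∃ z' : Fin s → ℂ, (∀ c : ℂ, z' ≠ c • (fun j => (p j).coeff μ)) ∧ ∀ i,
        ∑ j, z' j * MvPolynomial.eval (fun l => (p l).coeff μ)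
          (MvPolynomial.pderiv j (MvPolynomial.homogeneousComponent 2 (Γ i))) = 0) ∨
    (∃ w : Fin s → ℂ, ∀ i, ∑ j, (p j).coeff μ * MvPolynomial.eval w (MvPolynomial.pderiv j (Γ i)) = 0)

/-- STUB E-growth — MONOTONICITY AND DOUBLING OF THE E-FAMILY (closable, size S): for large `m`, `E(j) < E(j+1)`
for all `j`, and for every index `τ < m` some other index `i ≠ τ` has `E(2τ+2) < 2E(2i+2)` (take `i` = the top index
if `τ` is not the top one, else `i = m-2`, using `2E(2m-2) > E(2m)`: termwise `2(2m-2)^k ≥ (2m)^k (1 - 2k/m) ≥ 0`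
for `k ≤ h ≤ m/2`, strict at `k = 0`). -/
def Stmt.stub_expoGrowth : Prop :=
  ∃ m₀ : ℕ, ∀ m ≥ m₀,
    (∀ j : ℕ, (∑ k ∈ Finset.range (Nat.log 2 m ^ 2 + 1), (j * (2 * m + 2) ^ (Nat.log 2 m ^ 2 + 1)) ^ k) <
        ∑ k ∈ Finset.range (Nat.log 2 m ^ 2 + 1), ((j + 1) * (2 * m + 2) ^ (Nat.log 2 m ^ 2 + 1)) ^ k) ∧
    (∀ τ : Fin m, ∃ i : Fin m, i ≠ τ ∧
      (∑ k ∈ Finset.range (Nat.log 2 m ^ 2 + 1), ((2 * (τ : ℕ) + 2) * (2 * m + 2) ^ (Nat.log 2 m ^ 2 + 1)) ^ k) <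
        2 * ∑ k ∈ Finset.range (Nat.log 2 m ^ 2 + 1), ((2 * (i : ℕ) + 2) * (2 * m + 2) ^ (Nat.log 2 m ^ 2 + 1)) ^ k)

/-- STUB SHALLOW CORANK ONE (closable in pieces, size XL; generalises `stub_crossCap` from depth `2` to every depth
`d ≤ D`).  Integral solution `p`, base point `y₀ = p(0)`, corank one (the Jacobian columns have a one-dimensional kernel
`ℂκ`), data with (P1) at length `2D` and (P2) with factor `D`.  DEPTH: the base point is "deep to order `D`" if some
polynomial arc `γ(x)` with `γ(0) = y₀`, `γ'(0) = κ` has `Γ_i(γ(x)) ≡ 0 (mod x^{D+1})` for all `i` (a `D`-jet of a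
smooth arc inside the fibre `Γ⁻¹(0)`; `D = 1` always, `D = 2` iff NOT cross-cap, towers reach `2^{m-2}`).  Claim: if the
base point is NOT deep to order `D`, contradiction.  Proof route (c1 STRUCTURE.md §2c with `2 → d`): corank-one normal
form (`corankOne_normalForm`), Picard elimination of the regular coordinates with the kernel-curve jet `φ` and the depth
coefficients (`corankOne_iteration`: `f_{a,j}(0) = [x^j] B_a(x, φ(x))`), the depth `d ≤ D` = least `j` with
`(f_{0,j}(0), f_{1,j}(0)) ≠ 0` (else the arc `y₀ + S(x, φ(x))` is deep to order `D`), the Weierstrass eliminant of order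
`d` (`corankOne_eliminantMembership`: `C(det M) ∈ (F₀, F₁)`; `corankOne_eliminantLeadingForm`: `det M(0) = 0` and the
`W_1^d`-coefficient of `det M` is `((-c₀)/c₀)^d ≠ 0`), evaluation (`crossCap_evaluation`, landed) and uniqueness at
degree `d` (`lowDegreeVanishing_deg`, landed), transfer through `P` (`JetReduction.aeval_degGE`). -/
def Stmt.stub_shallowCorankOne : Prop :=
  ∀ m ≥ 2, ∀ (D : ℕ) (a b : Fin m → ℕ) (Γ : Fin m → MvPolynomial (Fin (m - 1)) ℂ) (N : ℕ)
    (p : Fin (m - 1) → LaurentSeries ℂ), (∀ i, (Γ i).totalDegree ≤ 2) → 0 < N →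
    (∀ j, 0 ≤ (p j).order) →
    (∀ i, 1 ≤ a i ∧ 1 ≤ b i) → 2 ≤ D →
    (∀ u v : Fin m → ℤ, ∑ i, (|u i| + |v i|) ≤ 2 * (D : ℤ) →
      ∑ i, (u i * (a i : ℤ) + v i * (b i : ℤ)) = 0 → (u, v) = 0) →
    (∃ M' : ℕ, (∀ i, a i % M' = 1 ∧ b i % M' = 1) ∧
      (∀ i j, D * a i < M' * a j ∧ D * a i < M' * b j ∧ D * b i < M' * a j ∧ D * b i < M' * b j)) →
    ∀ κ : Fin (m - 1) → ℂ, κ ≠ 0 →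
      (∀ i, ∑ j, κ j * MvPolynomial.eval (fun l => (p l).coeff 0) (MvPolynomial.pderiv j (Γ i)) = 0) →
      (∀ κ' : Fin (m - 1) → ℂ,
        (∀ i, ∑ j, κ' j * MvPolynomial.eval (fun l => (p l).coeff 0) (MvPolynomial.pderiv j (Γ i)) = 0) →
        ∃ μ : ℂ, κ' = μ • κ) →
      (¬ ∃ γ : Fin (m - 1) → Polynomial ℂ, (∀ j, (γ j).coeff 0 = (p j).coeff 0) ∧ (∀ j, (γ j).coeff 1 = κ j) ∧
        ∀ i, ∀ n ≤ D, (MvPolynomial.aeval γ (Γ i)).coeff n = 0) →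
      (∀ i, MvPolynomial.aeval p (Γ i) =
        HahnSeries.single ((N * a i : ℕ) : ℤ) (1 : ℂ) + HahnSeries.single ((N * b i : ℕ) : ℤ) (1 : ℂ)) →
      False

/-- STUB NONDEGENERATE CORANK TWO (closable in pieces, size XL; skeleton v6).  Integral solution `p`, base point
`y₀ = p(0)` of corank exactly two (kernel of the Jacobian columns = span(κ₁, κ₂)), three independent functionals `lam_a`
vanishing on the image of the differential (the special target directions), NONDEGENERATE: the three quadratic forms
`x ↦ lam_a · B(x, x)` on the kernel plane have no common nontrivial zero (for corank one this is the cross-cap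
condition), data with (P1) at length `2D` and (P2) with factor `D`, `D ≥ 8`.  Claim: contradiction.  Proof route
(STRUCTURE-c2.md §6): normal form with `Q_u = x₂²`, `Q_v = x₁²` (binaryQuadratic_squares, corankTwo_normalForm,
kernelPlane_coefficients), two-variable Picard elimination (corankTwo_iteration), first Weierstrass elimination of `X₂`
over `ℂ⟦W, X₁⟧` (eliminantMembership_option, order 2), `R_v(0; X₁)` of `X₁`-order exactly 4 (weightedNorm_order_four),
second elimination of `X₁` over `ℂ⟦W⟧` (corankOne_eliminantMembership, order 4), the axis restriction giving
`ρ(D) = W_w^8` exactly, evaluation (evaluation_powerSeries) and uniqueness at degree 8 (lowDegreeVanishing_deg). -/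
def Stmt.stub_nondegenerateCorankTwo : Prop :=
  ∀ m ≥ 3, ∀ (D : ℕ) (a b : Fin m → ℕ) (Γ : Fin m → MvPolynomial (Fin (m - 1)) ℂ) (N : ℕ)
    (p : Fin (m - 1) → LaurentSeries ℂ), (∀ i, (Γ i).totalDegree ≤ 2) → 0 < N →
    (∀ j, 0 ≤ (p j).order) →
    (∀ i, 1 ≤ a i ∧ 1 ≤ b i) → 8 ≤ D →
    (∀ u v : Fin m → ℤ, ∑ i, (|u i| + |v i|) ≤ 2 * (D : ℤ) →
      ∑ i, (u i * (a i : ℤ) + v i * (b i : ℤ)) = 0 → (u, v) = 0) →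
    (∃ M' : ℕ, (∀ i, a i % M' = 1 ∧ b i % M' = 1) ∧
      (∀ i j, D * a i < M' * a j ∧ D * a i < M' * b j ∧ D * b i < M' * a j ∧ D * b i < M' * b j)) →
    ∀ (κ₁ κ₂ : Fin (m - 1) → ℂ) (lam : Fin 3 → Fin m → ℂ),
      (∀ i, ∑ j, κ₁ j * MvPolynomial.eval (fun l => (p l).coeff 0) (MvPolynomial.pderiv j (Γ i)) = 0) →
      (∀ i, ∑ j, κ₂ j * MvPolynomial.eval (fun l => (p l).coeff 0) (MvPolynomial.pderiv j (Γ i)) = 0) →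
      (∀ c₁ c₂ : ℂ, c₁ • κ₁ + c₂ • κ₂ = 0 → c₁ = 0 ∧ c₂ = 0) →
      (∀ κ' : Fin (m - 1) → ℂ,
        (∀ i, ∑ j, κ' j * MvPolynomial.eval (fun l => (p l).coeff 0) (MvPolynomial.pderiv j (Γ i)) = 0) →
        ∃ μ₁ μ₂ : ℂ, κ' = μ₁ • κ₁ + μ₂ • κ₂) →
      (∀ a : Fin 3, ∀ j : Fin (m - 1),
        ∑ i, lam a i * MvPolynomial.eval (fun l => (p l).coeff 0) (MvPolynomial.pderiv j (Γ i)) = 0) →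
      (∀ c : Fin 3 → ℂ, (∀ i, ∑ a, c a * lam a i = 0) → c = 0) →
      (∀ x₁ x₂ : ℂ, (∀ a : Fin 3, ∑ i, lam a i *
          MvPolynomial.eval (x₁ • κ₁ + x₂ • κ₂) (MvPolynomial.homogeneousComponent 2 (Γ i)) = 0) → x₁ = 0 ∧ x₂ = 0) →
      (∀ i, MvPolynomial.aeval p (Γ i) =
        HahnSeries.single ((N * a i : ℕ) : ℤ) (1 : ℂ) + HahnSeries.single ((N * b i : ℕ) : ℤ) (1 : ℂ)) →
      False

/-! ## Stub statements — new in v7 (lead c3: the dimension count at infinity; closable) -/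

/-- STUB ∞-LA — AFFINE FUNCTIONS WITH PINNED DISTINCT ORDERS ARE TOO MANY (closable, size S/M; pure algebra).
`m` polynomials `A_i` of degree `≤ 1` on `ℂ^s` whose linear parts all annihilate a fixed nonzero vector `z` live in a space
of dimension `s`; if `s < m` they satisfy a nontrivial linear relation `Σ d_i A_i = 0` (coefficient vectors
`(coeff 0 A_i, (coeff X_k A_i)_k) ∈ ℂ × ℂ^s` lie in the hyperplane `Σ_k z_k a_k = 0`; e.g. drop the coordinate `k = j₀` with
`z_{j₀} ≠ 0` and use `Fintype.not_linearIndependent_iff` / `LinearIndependent.fintype_card_le_finrank`).  If moreover along a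
Laurent arc `r` the series `A_i(r(t))` are nonzero with pairwise distinct orders `e_i`, evaluating the relation along `r` is
absurd: with `i⋆` the index of least `e_i` among `{i : d_i ≠ 0}` (`Finset.exists_min_image`), the `t^{e_{i⋆}}` coefficient of
`Σ d_i A_i(r) = 0` is `d_{i⋆} · (A_{i⋆}(r)).coeff e_{i⋆} ≠ 0` (`HahnSeries.coeff_eq_zero_of_lt_order`,
`HahnSeries.coeff_order_ne_zero`). -/
def Stmt.stub_affineOrdersDependent : Prop :=
  ∀ (m s : ℕ) (z : Fin s → ℂ) (A : Fin m → MvPolynomial (Fin s) ℂ) (r : Fin s → LaurentSeries ℂ) (e : Fin m → ℤ),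
    s < m → z ≠ 0 → (∀ i, (A i).totalDegree ≤ 1) →
    (∀ i, ∑ k, z k * MvPolynomial.coeff (Finsupp.single k 1) (A i) = 0) →
    Function.Injective e →
    (∀ i, MvPolynomial.aeval r (A i) ≠ 0) → (∀ i, (MvPolynomial.aeval r (A i)).order = e i) → False

/-- STUB ∞-IR — ORDERS ALONG AN INTEGRAL REMAINDER AT INFINITY (closable, size M).  Data as in ∞-2' (`B_i(z) = 0` for all
`i`, `z = p_μ ≠ 0` the pole direction), and the remainder is INTEGRAL: all `2 × 2` minors `z_k p_j - z_j p_k` (which do not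
see the `Λ z` part of `p`) have no negative-order coefficients.  With `Λ := z_{j₀}⁻¹ p_{j₀}` (`z_{j₀} ≠ 0`; order `μ`, leading
coefficient `1`) and `r_j := p_j - z_j Λ = z_{j₀}⁻¹ (z_{j₀} p_j - z_j p_{j₀})` (integral), Taylor's formula for a polynomial
of degree `≤ 2` reads `Γ_i(r + Λ z) = Γ_i(r) + Λ · A_i(r) + Λ² B_i(z)` with `A_i := Σ_j z_j ∂_jΓ_i` (degree `≤ 1`; and
`Σ_k z_k ∂_kA_i = 2 B_i(z) = 0`).  As `B_i(z) = 0`, `Γ_i(r)` is integral, and the target `t^{-N a_i} + t^{-N b_i}` has least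
exponent `-N b_i < 0` (`a_i < b_i`), the product `Λ · A_i(r)` agrees with the target at every negative exponent: it is nonzero
of order exactly `-N b_i`, so `A_i(r) ≠ 0` has order `-N b_i - μ` (`HahnSeries.order_mul`).  Conclusion = the data of ∞-LA. -/
def Stmt.stub_infinityIntegralRemainderOrders : Prop :=
  ∀ (m s : ℕ) (a b : Fin m → ℕ) (Γ : Fin m → MvPolynomial (Fin s) ℂ) (N : ℕ) (p : Fin s → LaurentSeries ℂ) (μ : ℤ),
    (∀ i, (Γ i).totalDegree ≤ 2) → 0 < N → (∀ i, a i < b i) →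
    (∀ i, MvPolynomial.aeval p (Γ i) =
      HahnSeries.single (-((N * a i : ℕ) : ℤ)) (1 : ℂ) + HahnSeries.single (-((N * b i : ℕ) : ℤ)) (1 : ℂ)) →
    μ < 0 → (∀ j, ∀ g < μ, (p j).coeff g = 0) → (fun j => (p j).coeff μ) ≠ 0 →
    (∀ i, MvPolynomial.eval (fun j => (p j).coeff μ) (MvPolynomial.homogeneousComponent 2 (Γ i)) = 0) →
    (∀ j k, ∀ g < 0, ((p k).coeff μ • p j - (p j).coeff μ • p k).coeff g = 0) →
    ∃ (A : Fin m → MvPolynomial (Fin s) ℂ) (r : Fin s → LaurentSeries ℂ),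
      (∀ i, (A i).totalDegree ≤ 1) ∧
      (∀ i, ∑ k, (p k).coeff μ * MvPolynomial.coeff (Finsupp.single k 1) (A i) = 0) ∧
      (∀ i, MvPolynomial.aeval r (A i) ≠ 0) ∧
      (∀ i, (MvPolynomial.aeval r (A i)).order = -((N * b i : ℕ) : ℤ) - μ)

/-- STUB ∞-2'm — SECOND PEELING STEP AT INFINITY, improper branch, WITH THE INTEGRAL REMAINDER RECORDED (closable, size S/M:
`PolarStepTwo.exists_chart` (Theorems/BinomialElusiveBinomialCandidatePolarStepTwo.lean) gives `p = Λ q`, `q_j = z_j + v_j t^o + …`,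
`0 < o ≤ -μ`, `v_{j₀} = 0`, `v ≠ 0` if `o < -μ`; the branch `o < -μ` is verbatim the first branch of the tree proof of
`stub_infinityStepTwoImproper`; in the branch `o = -μ` the minors `z_k p_j - z_j p_k = Λ (z_k q_j - z_j q_k)` have no
coefficients below `μ + o = 0` (`PolarPeeling.coeff_mul_eq_zero_of_lt`: `z_k q_j - z_j q_k` has none below `o` by the jet
formula).  Same data as ∞-2'; conclusion: an isotropic second pole direction off one index, OR all minors integral. -/
def Stmt.stub_infinityStepTwoImproperMinors : Prop :=
  ∀ (m s : ℕ) (a b : Fin m → ℕ) (Γ : Fin m → MvPolynomial (Fin s) ℂ) (N : ℕ) (p : Fin s → LaurentSeries ℂ)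
    (μ : ℤ), 0 < m → (∀ i, (Γ i).totalDegree ≤ 2) → 0 < N → (∀ i, a i < b i) → Function.Injective b →
    (∀ i, MvPolynomial.aeval p (Γ i) =
      HahnSeries.single (-((N * a i : ℕ) : ℤ)) (1 : ℂ) + HahnSeries.single (-((N * b i : ℕ) : ℤ)) (1 : ℂ)) →
    μ < 0 → (∀ j, ∀ g < μ, (p j).coeff g = 0) → (fun j => (p j).coeff μ) ≠ 0 →
    (∀ i, MvPolynomial.eval (fun j => (p j).coeff μ) (MvPolynomial.homogeneousComponent 2 (Γ i)) = 0) →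
    (∃ z' : Fin s → ℂ, (∀ c : ℂ, z' ≠ c • (fun j => (p j).coeff μ)) ∧ ∃ i₁ : Fin m, ∀ i, i ≠ i₁ →
        ∑ j, z' j * MvPolynomial.eval (fun l => (p l).coeff μ)
          (MvPolynomial.pderiv j (MvPolynomial.homogeneousComponent 2 (Γ i))) = 0) ∨
    (∀ j k, ∀ g < 0, ((p k).coeff μ • p j - (p j).coeff μ • p k).coeff g = 0)

/-- STUB 0-polar-2m — SECOND PEELING STEP AT A POLE OVER `x = 0`, WITH THE INTEGRAL REMAINDER RECORDED (closable, size S/M: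
the tree proof of `stub_polarStepTwo` (Theorems/BinomialElusiveBinomialCandidatePolarStepTwo.lean, via `PolarStepTwo.exists_chart`)
with, in the integral branch `o = -μ`, the minors recorded as in ∞-2'm together with the VALUE `w = v` of the remainder:
`(z_k p_j - z_j p_k).coeff 0 = Λ.coeff μ · (z_k v_j - z_j v_k) = z_k w_j - z_j w_k` (`PolarPeeling.coeff_mul_eq`)).  Same data as
0-polar-2; conclusion: an isotropic second pole direction for ALL `i`, OR (all minors integral, their values at `0` given by a
point `w` — determined modulo `ℂz` — and `dΓ_i(w)·z = 0` for all `i`: the line `w + ℂz` is contracted by `Γ`). -/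
def Stmt.stub_polarStepTwoMinors : Prop :=
  ∀ (m s : ℕ) (a b : Fin m → ℕ) (Γ : Fin m → MvPolynomial (Fin s) ℂ) (N : ℕ) (p : Fin s → LaurentSeries ℂ)
    (μ : ℤ), (∀ i, (Γ i).totalDegree ≤ 2) → 0 < N →
    (∀ i, MvPolynomial.aeval p (Γ i) =
      HahnSeries.single ((N * a i : ℕ) : ℤ) (1 : ℂ) + HahnSeries.single ((N * b i : ℕ) : ℤ) (1 : ℂ)) →
    μ < 0 → (∀ j, ∀ g < μ, (p j).coeff g = 0) → (fun j => (p j).coeff μ) ≠ 0 →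
    (∀ i, MvPolynomial.eval (fun j => (p j).coeff μ) (MvPolynomial.homogeneousComponent 2 (Γ i)) = 0) →
    (∃ z' : Fin s → ℂ, (∀ c : ℂ, z' ≠ c • (fun j => (p j).coeff μ)) ∧ ∀ i,
        ∑ j, z' j * MvPolynomial.eval (fun l => (p l).coeff μ)
          (MvPolynomial.pderiv j (MvPolynomial.homogeneousComponent 2 (Γ i))) = 0) ∨
    ((∀ j k, ∀ g < 0, ((p k).coeff μ • p j - (p j).coeff μ • p k).coeff g = 0) ∧
      ∃ w : Fin s → ℂ,
        (∀ j k, ((p k).coeff μ • p j - (p j).coeff μ • p k).coeff 0 = (p k).coeff μ * w j - (p j).coeff μ * w k) ∧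
        ∀ i, ∑ j, (p j).coeff μ * MvPolynomial.eval w (MvPolynomial.pderiv j (Γ i)) = 0)

/-! ## Stub statements — open (reshaped: the deep cases, now carrying the structure at infinity) -/

/-- STUB DEEP-INTEGRAL (open; hardest; lead).  v3's `stub_nonImmersiveIntegral` narrowed three times.  (v6) in corank ≥ 2 the
NONDEGENERATE corank-two configurations are excluded (`stub_nondegenerateCorankTwo`): what remains there is corank ≥ 3 or a
degenerate net of special quadratic forms on the kernel plane.  (v5) The base point
`y₀ = p(0)` of the integral solution has corank ≥ 2 (two independent kernel vectors of the Jacobian columns), OR corank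
one with a DEEP ARC: a polynomial arc `γ`, `γ(0) = y₀`, `γ'(0) = κ`, with `Γ_i(γ(x)) ≡ 0 (mod x^{D+1})` for all `i`,
`D = ⌊log₂ m⌋²/2` (every shallower corank-one point is impossible: `stub_shallowCorankOne`).  (v4) ONE MORE
HYPOTHESIS, free from the place at infinity (∞-1/∞-2/∞-2'): a nonzero `z` such that either all quadratic parts
vanish at `z` (`Γ` improper) and (a second direction `z' ∉ ℂz` is killed by the polar forms `B_i(z, ·)` off one index,
or some line `w + ℂz` is contracted by all coordinates but one), or all but one quadratic part `B_τ` vanish at `z` and a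
second direction `z' ∉ ℂz` is killed by the polar forms off two indices.  Conclusion (general data): a nonzero
relation of length `≤ ⌊log₂ m⌋²`.  Why plausibly true / why it might fail: as PeelingLemma (GMOW arXiv:1904.04299 §9);
deep base points exist (repeated-squaring towers, STRUCTURE.md §2c) and must be met with geometry.  Size: XL (open). -/
def Stmt.stub_integralDeep : Prop :=
  ∃ m₀ : ℕ, ∀ m ≥ m₀, ∀ (a b : Fin m → ℕ) (Γ : Fin m → MvPolynomial (Fin (m - 1)) ℂ) (N : ℕ)
    (p : Fin (m - 1) → LaurentSeries ℂ), (∀ i, (Γ i).totalDegree ≤ 2) → 0 < N →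
    (∀ j, 0 ≤ (p j).order) →
    (((∃ κ₁ κ₂ : Fin (m - 1) → ℂ,
        (∀ i, ∑ j, κ₁ j * MvPolynomial.eval (fun l => (p l).coeff 0) (MvPolynomial.pderiv j (Γ i)) = 0) ∧
        (∀ i, ∑ j, κ₂ j * MvPolynomial.eval (fun l => (p l).coeff 0) (MvPolynomial.pderiv j (Γ i)) = 0) ∧
        ∀ c₁ c₂ : ℂ, c₁ • κ₁ + c₂ • κ₂ = 0 → c₁ = 0 ∧ c₂ = 0) ∧
      ¬ (∃ (κ₁ κ₂ : Fin (m - 1) → ℂ) (lam : Fin 3 → Fin m → ℂ),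
          (∀ i, ∑ j, κ₁ j * MvPolynomial.eval (fun l => (p l).coeff 0) (MvPolynomial.pderiv j (Γ i)) = 0) ∧
          (∀ i, ∑ j, κ₂ j * MvPolynomial.eval (fun l => (p l).coeff 0) (MvPolynomial.pderiv j (Γ i)) = 0) ∧
          (∀ c₁ c₂ : ℂ, c₁ • κ₁ + c₂ • κ₂ = 0 → c₁ = 0 ∧ c₂ = 0) ∧
          (∀ κ' : Fin (m - 1) → ℂ,
            (∀ i, ∑ j, κ' j * MvPolynomial.eval (fun l => (p l).coeff 0) (MvPolynomial.pderiv j (Γ i)) = 0) →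
            ∃ μ₁ μ₂ : ℂ, κ' = μ₁ • κ₁ + μ₂ • κ₂) ∧
          (∀ a : Fin 3, ∀ j : Fin (m - 1),
            ∑ i, lam a i * MvPolynomial.eval (fun l => (p l).coeff 0) (MvPolynomial.pderiv j (Γ i)) = 0) ∧
          (∀ c : Fin 3 → ℂ, (∀ i, ∑ a, c a * lam a i = 0) → c = 0) ∧
          (∀ x₁ x₂ : ℂ, (∀ a : Fin 3, ∑ i, lam a i *
              MvPolynomial.eval (x₁ • κ₁ + x₂ • κ₂) (MvPolynomial.homogeneousComponent 2 (Γ i)) = 0) → x₁ = 0 ∧ x₂ = 0))) ∨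
      (∃ κ : Fin (m - 1) → ℂ, κ ≠ 0 ∧
        (∀ i, ∑ j, κ j * MvPolynomial.eval (fun l => (p l).coeff 0) (MvPolynomial.pderiv j (Γ i)) = 0) ∧
        (∀ κ' : Fin (m - 1) → ℂ,
          (∀ i, ∑ j, κ' j * MvPolynomial.eval (fun l => (p l).coeff 0) (MvPolynomial.pderiv j (Γ i)) = 0) →
          ∃ μ : ℂ, κ' = μ • κ) ∧
        ∃ γ : Fin (m - 1) → Polynomial ℂ, (∀ j, (γ j).coeff 0 = (p j).coeff 0) ∧ (∀ j, (γ j).coeff 1 = κ j) ∧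
          ∀ i, ∀ n ≤ Nat.log 2 m ^ 2 / 2, (MvPolynomial.aeval γ (Γ i)).coeff n = 0)) →
    (∃ z : Fin (m - 1) → ℂ, z ≠ 0 ∧ ∃ z' : Fin (m - 1) → ℂ, (∀ c : ℂ, z' ≠ c • z) ∧
      (((∀ i, MvPolynomial.eval z (MvPolynomial.homogeneousComponent 2 (Γ i)) = 0) ∧
        ∃ i₁ : Fin m, ∀ i, i ≠ i₁ →
          ∑ j, z' j * MvPolynomial.eval z
            (MvPolynomial.pderiv j (MvPolynomial.homogeneousComponent 2 (Γ i))) = 0) ∨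
      (∃ τ : Fin m, (∀ i, i ≠ τ → MvPolynomial.eval z (MvPolynomial.homogeneousComponent 2 (Γ i)) = 0) ∧
        ∃ i₁ : Fin m, ∀ i, i ≠ τ → i ≠ i₁ →
          ∑ j, z' j * MvPolynomial.eval z
            (MvPolynomial.pderiv j (MvPolynomial.homogeneousComponent 2 (Γ i))) = 0))) →
    (∀ i, MvPolynomial.aeval p (Γ i) =
      HahnSeries.single ((N * a i : ℕ) : ℤ) (1 : ℂ) + HahnSeries.single ((N * b i : ℕ) : ℤ) (1 : ℂ)) →
    ∃ u v : Fin m → ℤ, (u, v) ≠ 0 ∧ ∑ i, (|u i| + |v i|) ≤ ((Nat.log 2 m ^ 2 : ℕ) : ℤ) ∧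
      ∑ i, (u i * (a i : ℤ) + v i * (b i : ℤ)) = 0

/-- STUB DEEP-POLAR (open).  v3's `stub_polarPeeling` — a Laurent solution at the place over `0` with a genuine pole —
with the structure now known for free as hypotheses: the least order `μ < 0` and `z = p_μ ≠ 0`; `B_i(z) = 0` for ALL
`i` (`polar_forces_commonZero`, p150597: `Γ` is improper); the step-2 dichotomy of `stub_polarStepTwo` (isotropic
second direction for all `i`, or a point `w` with `dΓ(w)·z = 0`, i.e. a contracted line `w + ℂz`); and the structure at
infinity as in `stub_integralDeep`.  Conclusion (general data): a nonzero relation of length `≤ ⌊log₂ m⌋²`.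
Size: XL (open). -/
def Stmt.stub_polarDeep : Prop :=
  ∃ m₀ : ℕ, ∀ m ≥ m₀, ∀ (a b : Fin m → ℕ) (Γ : Fin m → MvPolynomial (Fin (m - 1)) ℂ) (N : ℕ)
    (p : Fin (m - 1) → LaurentSeries ℂ) (μ : ℤ), (∀ i, (Γ i).totalDegree ≤ 2) → 0 < N →
    μ < 0 → (∀ j, ∀ g < μ, (p j).coeff g = 0) → (fun j => (p j).coeff μ) ≠ 0 →
    (∀ i, MvPolynomial.eval (fun j => (p j).coeff μ) (MvPolynomial.homogeneousComponent 2 (Γ i)) = 0) →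
    ((∃ z' : Fin (m - 1) → ℂ, (∀ c : ℂ, z' ≠ c • (fun j => (p j).coeff μ)) ∧ ∀ i,
        ∑ j, z' j * MvPolynomial.eval (fun l => (p l).coeff μ)
          (MvPolynomial.pderiv j (MvPolynomial.homogeneousComponent 2 (Γ i))) = 0) ∨
      ((∀ j k, ∀ g < 0, ((p k).coeff μ • p j - (p j).coeff μ • p k).coeff g = 0) ∧
        ∃ w : Fin (m - 1) → ℂ,
          (∀ j k, ((p k).coeff μ • p j - (p j).coeff μ • p k).coeff 0 = (p k).coeff μ * w j - (p j).coeff μ * w k) ∧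
          ∀ i, ∑ j, (p j).coeff μ * MvPolynomial.eval w (MvPolynomial.pderiv j (Γ i)) = 0)) →
    (∃ z : Fin (m - 1) → ℂ, z ≠ 0 ∧ ∃ z' : Fin (m - 1) → ℂ, (∀ c : ℂ, z' ≠ c • z) ∧
      (((∀ i, MvPolynomial.eval z (MvPolynomial.homogeneousComponent 2 (Γ i)) = 0) ∧
        ∃ i₁ : Fin m, ∀ i, i ≠ i₁ →
          ∑ j, z' j * MvPolynomial.eval z
            (MvPolynomial.pderiv j (MvPolynomial.homogeneousComponent 2 (Γ i))) = 0) ∨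
      (∃ τ : Fin m, (∀ i, i ≠ τ → MvPolynomial.eval z (MvPolynomial.homogeneousComponent 2 (Γ i)) = 0) ∧
        ∃ i₁ : Fin m, ∀ i, i ≠ τ → i ≠ i₁ →
          ∑ j, z' j * MvPolynomial.eval z
            (MvPolynomial.pderiv j (MvPolynomial.homogeneousComponent 2 (Γ i))) = 0))) →
    (∀ i, MvPolynomial.aeval p (Γ i) =
      HahnSeries.single ((N * a i : ℕ) : ℤ) (1 : ℂ) + HahnSeries.single ((N * b i : ℕ) : ℤ) (1 : ℂ)) →
    ∃ u v : Fin m → ℤ, (u, v) ≠ 0 ∧ ∑ i, (|u i| + |v i|) ≤ ((Nat.log 2 m ^ 2 : ℕ) : ℤ) ∧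
      ∑ i, (u i * (a i : ℤ) + v i * (b i : ℤ)) = 0

/-! ## Registered stubs (the ONLY sorries of this file; landed ones are linked to their Theorems decl) -/

/-- Registered stub 1a = `Stmt.stub_jetReduction` — LANDED (p155296):
`Summit.ValiantsHypothesis.ValiantsHypothesis.Theorems.BinomialCandidateStubs.stub_jetReduction`. -/
theorem stub_jetReduction : Stmt.stub_jetReduction :=
  Summit.ValiantsHypothesis.ValiantsHypothesis.Theorems.BinomialCandidateStubs.stub_jetReduction

/-- Registered stub 1b = `Stmt.stub_lowDegreeVanishing` — LANDED (p151884):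
`Summit.ValiantsHypothesis.ValiantsHypothesis.Theorems.BinomialCandidateStubs.stub_lowDegreeVanishing`. -/
theorem stub_lowDegreeVanishing : Stmt.stub_lowDegreeVanishing :=
  Summit.ValiantsHypothesis.ValiantsHypothesis.Theorems.BinomialCandidateStubs.stub_lowDegreeVanishing

/-- Registered stub 1c = `Stmt.stub_crossCap` — LANDED (p155996):
`Summit.ValiantsHypothesis.ValiantsHypothesis.Theorems.BinomialCandidateStubs.stub_crossCap`. -/
theorem stub_crossCap : Stmt.stub_crossCap :=
  Summit.ValiantsHypothesis.ValiantsHypothesis.Theorems.BinomialCandidateStubs.stub_crossCap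

/-- Registered stub 4 = `Stmt.stub_expoCongruence` — LANDED (p151550, witness m₀ = 16):
`Summit.ValiantsHypothesis.ValiantsHypothesis.Theorems.BinomialCandidateStubs.stub_expoCongruence`. -/
theorem stub_expoCongruence : Stmt.stub_expoCongruence :=
  Summit.ValiantsHypothesis.ValiantsHypothesis.Theorems.BinomialCandidateStubs.stub_expoCongruence

/-- Registered stub ∞-0 = `Stmt.stub_infinityGlue` — LANDED (p159604, wave 1 of lead c2):
`Summit.ValiantsHypothesis.ValiantsHypothesis.Theorems.BinomialCandidateStubs.stub_infinityGlue`. -/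
theorem stub_infinityGlue : Stmt.stub_infinityGlue :=
  Summit.ValiantsHypothesis.ValiantsHypothesis.Theorems.BinomialCandidateStubs.stub_infinityGlue

/-- Registered stub ∞-1 = `Stmt.stub_infinityCommonZero` — LANDED (p159975, wave 1 of lead c2):
`Summit.ValiantsHypothesis.ValiantsHypothesis.Theorems.BinomialCandidateStubs.stub_infinityCommonZero`. -/
theorem stub_infinityCommonZero : Stmt.stub_infinityCommonZero :=
  Summit.ValiantsHypothesis.ValiantsHypothesis.Theorems.BinomialCandidateStubs.stub_infinityCommonZero

/-- Registered stub ∞-2 = `Stmt.stub_infinityStepTwo` — LANDED (p160585, wave 1 of lead c2):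
`Summit.ValiantsHypothesis.ValiantsHypothesis.Theorems.BinomialCandidateStubs.stub_infinityStepTwo`. -/
theorem stub_infinityStepTwo : Stmt.stub_infinityStepTwo :=
  Summit.ValiantsHypothesis.ValiantsHypothesis.Theorems.BinomialCandidateStubs.stub_infinityStepTwo

/-- Registered stub ∞-2' = `Stmt.stub_infinityStepTwoImproper` — LANDED (p161411, wave 1 of lead c2):
`Summit.ValiantsHypothesis.ValiantsHypothesis.Theorems.BinomialCandidateStubs.stub_infinityStepTwoImproper`. -/
theorem stub_infinityStepTwoImproper : Stmt.stub_infinityStepTwoImproper :=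
  Summit.ValiantsHypothesis.ValiantsHypothesis.Theorems.BinomialCandidateStubs.stub_infinityStepTwoImproper

/-- Registered stub 0-polar-2 = `Stmt.stub_polarStepTwo` — LANDED (p161670, wave 1 of lead c2):
`Summit.ValiantsHypothesis.ValiantsHypothesis.Theorems.BinomialCandidateStubs.stub_polarStepTwo`. -/
theorem stub_polarStepTwo : Stmt.stub_polarStepTwo :=
  Summit.ValiantsHypothesis.ValiantsHypothesis.Theorems.BinomialCandidateStubs.stub_polarStepTwo

/-- Registered stub E-growth = `Stmt.stub_expoGrowth` — LANDED (p162096, wave 1 of lead c2):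
`Summit.ValiantsHypothesis.ValiantsHypothesis.Theorems.BinomialCandidateStubs.stub_expoGrowth`. -/
theorem stub_expoGrowth : Stmt.stub_expoGrowth :=
  Summit.ValiantsHypothesis.ValiantsHypothesis.Theorems.BinomialCandidateStubs.stub_expoGrowth

/-- Registered stub SHALLOW CORANK ONE = `Stmt.stub_shallowCorankOne` — LANDED (p164422, wave 2 of lead c2; pieces p163637 normal form,
p163772 iteration, p163861 eliminant membership, p163976 eliminant leading form):
`Summit.ValiantsHypothesis.ValiantsHypothesis.Theorems.BinomialCandidateStubs.stub_shallowCorankOne`. -/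
theorem stub_shallowCorankOne : Stmt.stub_shallowCorankOne :=
  Summit.ValiantsHypothesis.ValiantsHypothesis.Theorems.BinomialCandidateStubs.stub_shallowCorankOne

/-- Registered stub NONDEGENERATE CORANK TWO = `Stmt.stub_nondegenerateCorankTwo` — LANDED (p169202, cycle 3 of lead c2; pieces p167520 p167073 p167419
p166844 p166935 p167792 p166591 p166693 p166655 p167855 p168208 p169018):
`Summit.ValiantsHypothesis.ValiantsHypothesis.Theorems.BinomialCandidateStubs.stub_nondegenerateCorankTwo`. -/
theorem stub_nondegenerateCorankTwo : Stmt.stub_nondegenerateCorankTwo :=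
  Summit.ValiantsHypothesis.ValiantsHypothesis.Theorems.BinomialCandidateStubs.stub_nondegenerateCorankTwo

/-- Registered stub ∞-LA = `Stmt.stub_affineOrdersDependent` — LANDED (p172816, wave 1 of lead c3):
`Summit.ValiantsHypothesis.ValiantsHypothesis.Theorems.BinomialCandidateStubs.stub_affineOrdersDependent`. -/
theorem stub_affineOrdersDependent : Stmt.stub_affineOrdersDependent :=
  Summit.ValiantsHypothesis.ValiantsHypothesis.Theorems.BinomialCandidateStubs.stub_affineOrdersDependent

/-- Registered stub ∞-IR = `Stmt.stub_infinityIntegralRemainderOrders` — LANDED (p173313, wave 1 of lead c3):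
`Summit.ValiantsHypothesis.ValiantsHypothesis.Theorems.BinomialCandidateStubs.stub_infinityIntegralRemainderOrders`. -/
theorem stub_infinityIntegralRemainderOrders : Stmt.stub_infinityIntegralRemainderOrders :=
  Summit.ValiantsHypothesis.ValiantsHypothesis.Theorems.BinomialCandidateStubs.stub_infinityIntegralRemainderOrders

/-- Registered stub ∞-2'm = `Stmt.stub_infinityStepTwoImproperMinors` — LANDED (p173026, wave 1 of lead c3):
`Summit.ValiantsHypothesis.ValiantsHypothesis.Theorems.BinomialCandidateStubs.stub_infinityStepTwoImproperMinors`. -/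
theorem stub_infinityStepTwoImproperMinors : Stmt.stub_infinityStepTwoImproperMinors :=
  Summit.ValiantsHypothesis.ValiantsHypothesis.Theorems.BinomialCandidateStubs.stub_infinityStepTwoImproperMinors

/-- Registered stub 0-polar-2m = `Stmt.stub_polarStepTwoMinors` — LANDED (p173070, wave 1 of lead c3):
`Summit.ValiantsHypothesis.ValiantsHypothesis.Theorems.BinomialCandidateStubs.stub_polarStepTwoMinors`. -/
theorem stub_polarStepTwoMinors : Stmt.stub_polarStepTwoMinors :=
  Summit.ValiantsHypothesis.ValiantsHypothesis.Theorems.BinomialCandidateStubs.stub_polarStepTwoMinors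

/-- Registered stub DEEP-INTEGRAL = `Stmt.stub_integralDeep` (open). -/
theorem stub_integralDeep :
    ∃ m₀ : ℕ, ∀ m ≥ m₀, ∀ (a b : Fin m → ℕ) (Γ : Fin m → MvPolynomial (Fin (m - 1)) ℂ) (N : ℕ)
      (p : Fin (m - 1) → LaurentSeries ℂ), (∀ i, (Γ i).totalDegree ≤ 2) → 0 < N →
      (∀ j, 0 ≤ (p j).order) →
      (((∃ κ₁ κ₂ : Fin (m - 1) → ℂ,
          (∀ i, ∑ j, κ₁ j * MvPolynomial.eval (fun l => (p l).coeff 0) (MvPolynomial.pderiv j (Γ i)) = 0) ∧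
          (∀ i, ∑ j, κ₂ j * MvPolynomial.eval (fun l => (p l).coeff 0) (MvPolynomial.pderiv j (Γ i)) = 0) ∧
          ∀ c₁ c₂ : ℂ, c₁ • κ₁ + c₂ • κ₂ = 0 → c₁ = 0 ∧ c₂ = 0) ∧
        ¬ (∃ (κ₁ κ₂ : Fin (m - 1) → ℂ) (lam : Fin 3 → Fin m → ℂ),
            (∀ i, ∑ j, κ₁ j * MvPolynomial.eval (fun l => (p l).coeff 0) (MvPolynomial.pderiv j (Γ i)) = 0) ∧
            (∀ i, ∑ j, κ₂ j * MvPolynomial.eval (fun l => (p l).coeff 0) (MvPolynomial.pderiv j (Γ i)) = 0) ∧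
            (∀ c₁ c₂ : ℂ, c₁ • κ₁ + c₂ • κ₂ = 0 → c₁ = 0 ∧ c₂ = 0) ∧
            (∀ κ' : Fin (m - 1) → ℂ,
              (∀ i, ∑ j, κ' j * MvPolynomial.eval (fun l => (p l).coeff 0) (MvPolynomial.pderiv j (Γ i)) = 0) →
              ∃ μ₁ μ₂ : ℂ, κ' = μ₁ • κ₁ + μ₂ • κ₂) ∧
            (∀ a : Fin 3, ∀ j : Fin (m - 1),
              ∑ i, lam a i * MvPolynomial.eval (fun l => (p l).coeff 0) (MvPolynomial.pderiv j (Γ i)) = 0) ∧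
            (∀ c : Fin 3 → ℂ, (∀ i, ∑ a, c a * lam a i = 0) → c = 0) ∧
            (∀ x₁ x₂ : ℂ, (∀ a : Fin 3, ∑ i, lam a i *
                MvPolynomial.eval (x₁ • κ₁ + x₂ • κ₂) (MvPolynomial.homogeneousComponent 2 (Γ i)) = 0) → x₁ = 0 ∧ x₂ = 0))) ∨
        (∃ κ : Fin (m - 1) → ℂ, κ ≠ 0 ∧
          (∀ i, ∑ j, κ j * MvPolynomial.eval (fun l => (p l).coeff 0) (MvPolynomial.pderiv j (Γ i)) = 0) ∧
          (∀ κ' : Fin (m - 1) → ℂ,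
            (∀ i, ∑ j, κ' j * MvPolynomial.eval (fun l => (p l).coeff 0) (MvPolynomial.pderiv j (Γ i)) = 0) →
            ∃ μ : ℂ, κ' = μ • κ) ∧
          ∃ γ : Fin (m - 1) → Polynomial ℂ, (∀ j, (γ j).coeff 0 = (p j).coeff 0) ∧ (∀ j, (γ j).coeff 1 = κ j) ∧
            ∀ i, ∀ n ≤ Nat.log 2 m ^ 2 / 2, (MvPolynomial.aeval γ (Γ i)).coeff n = 0)) →
      (∃ z : Fin (m - 1) → ℂ, z ≠ 0 ∧ ∃ z' : Fin (m - 1) → ℂ, (∀ c : ℂ, z' ≠ c • z) ∧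
        (((∀ i, MvPolynomial.eval z (MvPolynomial.homogeneousComponent 2 (Γ i)) = 0) ∧
          ∃ i₁ : Fin m, ∀ i, i ≠ i₁ →
            ∑ j, z' j * MvPolynomial.eval z
              (MvPolynomial.pderiv j (MvPolynomial.homogeneousComponent 2 (Γ i))) = 0) ∨
        (∃ τ : Fin m, (∀ i, i ≠ τ → MvPolynomial.eval z (MvPolynomial.homogeneousComponent 2 (Γ i)) = 0) ∧
          ∃ i₁ : Fin m, ∀ i, i ≠ τ → i ≠ i₁ →
            ∑ j, z' j * MvPolynomial.eval z
              (MvPolynomial.pderiv j (MvPolynomial.homogeneousComponent 2 (Γ i))) = 0))) →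
      (∀ i, MvPolynomial.aeval p (Γ i) =
        HahnSeries.single ((N * a i : ℕ) : ℤ) (1 : ℂ) + HahnSeries.single ((N * b i : ℕ) : ℤ) (1 : ℂ)) →
      ∃ u v : Fin m → ℤ, (u, v) ≠ 0 ∧ ∑ i, (|u i| + |v i|) ≤ ((Nat.log 2 m ^ 2 : ℕ) : ℤ) ∧
        ∑ i, (u i * (a i : ℤ) + v i * (b i : ℤ)) = 0 := by
  sorry

/-- Registered stub DEEP-POLAR = `Stmt.stub_polarDeep` (open). -/
theorem stub_polarDeep :
    ∃ m₀ : ℕ, ∀ m ≥ m₀, ∀ (a b : Fin m → ℕ) (Γ : Fin m → MvPolynomial (Fin (m - 1)) ℂ) (N : ℕ)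
      (p : Fin (m - 1) → LaurentSeries ℂ) (μ : ℤ), (∀ i, (Γ i).totalDegree ≤ 2) → 0 < N →
      μ < 0 → (∀ j, ∀ g < μ, (p j).coeff g = 0) → (fun j => (p j).coeff μ) ≠ 0 →
      (∀ i, MvPolynomial.eval (fun j => (p j).coeff μ) (MvPolynomial.homogeneousComponent 2 (Γ i)) = 0) →
      ((∃ z' : Fin (m - 1) → ℂ, (∀ c : ℂ, z' ≠ c • (fun j => (p j).coeff μ)) ∧ ∀ i,
          ∑ j, z' j * MvPolynomial.eval (fun l => (p l).coeff μ)
            (MvPolynomial.pderiv j (MvPolynomial.homogeneousComponent 2 (Γ i))) = 0) ∨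
        ((∀ j k, ∀ g < 0, ((p k).coeff μ • p j - (p j).coeff μ • p k).coeff g = 0) ∧
          ∃ w : Fin (m - 1) → ℂ,
            (∀ j k, ((p k).coeff μ • p j - (p j).coeff μ • p k).coeff 0 = (p k).coeff μ * w j - (p j).coeff μ * w k) ∧
            ∀ i, ∑ j, (p j).coeff μ * MvPolynomial.eval w (MvPolynomial.pderiv j (Γ i)) = 0)) →
      (∃ z : Fin (m - 1) → ℂ, z ≠ 0 ∧ ∃ z' : Fin (m - 1) → ℂ, (∀ c : ℂ, z' ≠ c • z) ∧
        (((∀ i, MvPolynomial.eval z (MvPolynomial.homogeneousComponent 2 (Γ i)) = 0) ∧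
          ∃ i₁ : Fin m, ∀ i, i ≠ i₁ →
            ∑ j, z' j * MvPolynomial.eval z
              (MvPolynomial.pderiv j (MvPolynomial.homogeneousComponent 2 (Γ i))) = 0) ∨
        (∃ τ : Fin m, (∀ i, i ≠ τ → MvPolynomial.eval z (MvPolynomial.homogeneousComponent 2 (Γ i)) = 0) ∧
          ∃ i₁ : Fin m, ∀ i, i ≠ τ → i ≠ i₁ →
            ∑ j, z' j * MvPolynomial.eval z
              (MvPolynomial.pderiv j (MvPolynomial.homogeneousComponent 2 (Γ i))) = 0))) →
      (∀ i, MvPolynomial.aeval p (Γ i) =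
        HahnSeries.single ((N * a i : ℕ) : ℤ) (1 : ℂ) + HahnSeries.single ((N * b i : ℕ) : ℤ) (1 : ℂ)) →
      ∃ u v : Fin m → ℤ, (u, v) ≠ 0 ∧ ∑ i, (|u i| + |v i|) ≤ ((Nat.log 2 m ^ 2 : ℕ) : ℤ) ∧
        ∑ i, (u i * (a i : ℤ) + v i * (b i : ℤ)) = 0 := by
  sorry

/-! ## The composition (kernel-checked, sorry-free) -/

/-- NoShortRelations (proved support, stmt-7395) in the form the stubs consume: the X-exponents
`a_i = E(2i+1)`, `b_i = E(2i+2)` admit no nonzero integer relation of length `≤ ⌊log₂ m⌋²`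
(interleave `(u, v)` into `w : Fin (2m) → ℤ`, `w(2i) = u_i`, `w(2i+1) = v_i`). -/
theorem xData_noShortRelation (m : ℕ) (u v : Fin m → ℤ)
    (hlen : ∑ i, (|u i| + |v i|) ≤ ((Nat.log 2 m ^ 2 : ℕ) : ℤ))
    (hrel : ∑ i, (u i * ((expo m (2 * (i : ℕ) + 1) : ℕ) : ℤ) + v i * ((expo m (2 * (i : ℕ) + 2) : ℕ) : ℤ)) = 0) :
    (u, v) = 0 := by
  -- Step 3 (NoShortRelations, proved support): interleave `(u, v)` into `w : Fin (2m) → ℤ`.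
  let e : Fin m × Fin 2 ≃ Fin (2 * m) := finProdFinEquiv.trans (finCongr (Nat.mul_comm m 2))
  let F : Fin m × Fin 2 → ℤ := fun x => ![u x.1, v x.1] x.2
  let w : Fin (2 * m) → ℤ := fun j => F (e.symm j)
  have hwF : ∀ x, w (e x) = F x := fun x => by simp [w]
  have he : ∀ x : Fin m × Fin 2, ((e x : Fin (2 * m)) : ℕ) = (x.2 : ℕ) + 2 * (x.1 : ℕ) := by
    intro x
    simp [e]
  have he0 : ∀ i : Fin m, ((e (i, 0) : Fin (2 * m)) : ℕ) + 1 = 2 * (i : ℕ) + 1 := fun i => by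
    rw [he]; simp
  have he1 : ∀ i : Fin m, ((e (i, 1) : Fin (2 * m)) : ℕ) + 1 = 2 * (i : ℕ) + 2 := fun i => by
    rw [he]; simp only [Fin.isValue, Fin.val_one]; omega
  have habs : ∑ j, |w j| = ∑ i, (|u i| + |v i|) := by
    rw [← Fintype.sum_equiv e (fun x => |F x|) (fun j => |w j|) (fun x => by rw [hwF]),
      Fintype.sum_prod_type]
    refine Finset.sum_congr rfl fun i _ => ?_
    rw [Fin.sum_univ_two]
    simp [F]
  have hrelw : ∑ j, w j * ((expo m ((j : ℕ) + 1) : ℕ) : ℤ) =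
      ∑ i, (u i * ((expo m (2 * (i : ℕ) + 1) : ℕ) : ℤ) + v i * ((expo m (2 * (i : ℕ) + 2) : ℕ) : ℤ)) := by
    rw [← Fintype.sum_equiv e (fun x => F x * ((expo m (((e x : Fin (2 * m)) : ℕ) + 1) : ℕ) : ℤ))
      (fun j => w j * ((expo m ((j : ℕ) + 1) : ℕ) : ℤ)) (fun x => by rw [hwF]), Fintype.sum_prod_type]
    refine Finset.sum_congr rfl fun i _ => ?_
    rw [Fin.sum_univ_two, he0, he1]
    simp [F]
  have hw0 : w = 0 :=
    Summit.ValiantsHypothesis.ValiantsHypothesis.Theorems.BinomialElusiveNoShortRelations.noShortRelations_proof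
      m (Nat.log 2 m ^ 2) w (by rw [habs]; exact hlen) (by
        show ∑ j, w j * ((expo m ((j : ℕ) + 1) : ℕ) : ℤ) = 0
        rw [hrelw]
        exact hrel)
  have hu : u = 0 := funext fun i => by simpa [hwF, F] using congr_fun hw0 (e (i, 0))
  have hv : v = 0 := funext fun i => by simpa [hwF, F] using congr_fun hw0 (e (i, 1))
  rw [hu, hv]; rfl

/-- `4 ≤ ⌊log₂ m⌋²` once `m ≥ 4`. -/
theorem four_le_log_sq {m : ℕ} (hm : 4 ≤ m) : (4 : ℤ) ≤ ((Nat.log 2 m ^ 2 : ℕ) : ℤ) := by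
  have h2 : 2 ≤ Nat.log 2 m := Nat.le_log_of_pow_le (by norm_num) (by simpa using hm)
  have : 4 ≤ Nat.log 2 m ^ 2 := by nlinarith
  exact_mod_cast this

/-- `L⁴ ≤ 2^{L+1}` for `L ≥ 15` (so that `D (h+1) ≤ 2m+2` for `D = h/2`, `h = ⌊log₂ m⌋²`, `m ≥ 2¹⁵`). -/
theorem pow_four_le_two_pow (L : ℕ) (hL : 15 ≤ L) : L ^ 4 ≤ 2 ^ (L + 1) := by
  induction L, hL using Nat.le_induction with
  | base => norm_num
  | succ L hL ih =>
    calc (L + 1) ^ 4 ≤ 2 * L ^ 4 := by nlinarith [pow_pos (show 0 < L by omega) 2, pow_pos (show 0 < L by omega) 3]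
      _ ≤ 2 * 2 ^ (L + 1) := Nat.mul_le_mul_left 2 ih
      _ = 2 ^ (L + 1 + 1) := by rw [pow_succ' 2 (L + 1)]

/-- Injectivity of `i ↦ E(2i+2)` from NoShortRelations at length `2` (`m ≥ 4`). -/
theorem b_injective {m : ℕ} (hm : 4 ≤ m) :
    Function.Injective (fun i : Fin m => expo m (2 * (i : ℕ) + 2)) := by
  intro i j hij
  by_contra hne
  classical
  have h := xData_noShortRelation m 0 (Pi.single i 1 - Pi.single j 1) ?_ ?_
  · have := congr_fun (Prod.mk.inj h).2 i
    simp [Pi.sub_apply, hne] at this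
  · calc ∑ k, (|(0 : Fin m → ℤ) k| + |(Pi.single i 1 - Pi.single j 1 : Fin m → ℤ) k|)
        ≤ ∑ k, ((if k = i then 1 else 0) + (if k = j then 1 else 0) : ℤ) := by
          refine Finset.sum_le_sum fun k _ => ?_
          simp only [Pi.zero_apply, abs_zero, zero_add, Pi.sub_apply, Pi.single_apply]
          split_ifs <;> simp
      _ = 2 := by simp [Finset.sum_add_distrib]
      _ ≤ _ := by linarith [four_le_log_sq hm]
  · simp only [Pi.zero_apply, zero_mul, zero_add, Pi.sub_apply, Pi.single_apply, sub_mul, ite_mul, one_mul,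
      zero_mul, Finset.sum_sub_distrib, Finset.sum_ite_eq', Finset.mem_univ, if_true]
    simp only [hij, sub_self]

/-- The structure at infinity handed to the deep stubs (abbreviation used only inside this file's proofs; v7: TWO pole
directions `z`, `z' ∉ ℂz` in both branches — the integral-remainder branch of v4–v6 is empty by the dimension count). -/
def InftyStructure {m : ℕ} (Γ : Fin m → MvPolynomial (Fin (m - 1)) ℂ) : Prop :=
  ∃ z : Fin (m - 1) → ℂ, z ≠ 0 ∧ ∃ z' : Fin (m - 1) → ℂ, (∀ c : ℂ, z' ≠ c • z) ∧
    (((∀ i, MvPolynomial.eval z (MvPolynomial.homogeneousComponent 2 (Γ i)) = 0) ∧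
      ∃ i₁ : Fin m, ∀ i, i ≠ i₁ →
        ∑ j, z' j * MvPolynomial.eval z
          (MvPolynomial.pderiv j (MvPolynomial.homogeneousComponent 2 (Γ i))) = 0) ∨
    (∃ τ : Fin m, (∀ i, i ≠ τ → MvPolynomial.eval z (MvPolynomial.homogeneousComponent 2 (Γ i)) = 0) ∧
      ∃ i₁ : Fin m, ∀ i, i ≠ τ → i ≠ i₁ →
        ∑ j, z' j * MvPolynomial.eval z
          (MvPolynomial.pderiv j (MvPolynomial.homogeneousComponent 2 (Γ i))) = 0))

/-- **The structure at infinity** (from stubs ∞-0, ∞-1, ∞-2, ∞-2'm, ∞-IR, ∞-LA and E-growth): every quadratic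
`Γ : ℂ^{m-1} → ℂ^m` whose image contains the E-curve (`m` large) has a nonzero `z` at which all but at most one quadratic part
vanish, AND a second direction `z' ∉ ℂz` killed by the polar forms `B_i(z, ·)` off at most two indices (v7: in the improper
branch the integral-remainder alternative is contradictory — `m` translation-invariant affine functions on `ℂ^{m-1}` with
pairwise distinct orders along the remainder). -/
theorem inftyStructure_of_range (h₀ : Stmt.stub_infinityGlue) (h₁ : Stmt.stub_infinityCommonZero)
    (h₂ : Stmt.stub_infinityStepTwo) (h₂m : Stmt.stub_infinityStepTwoImproperMinors)
    (hIR : Stmt.stub_infinityIntegralRemainderOrders) (hLA : Stmt.stub_affineOrdersDependent) {m : ℕ} (hm4 : 4 ≤ m)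
    (hmono : ∀ j : ℕ, expo m j < expo m (j + 1))
    (hdbl : ∀ τ : Fin m, ∃ i : Fin m, i ≠ τ ∧ expo m (2 * (τ : ℕ) + 2) < 2 * expo m (2 * (i : ℕ) + 2))
    (Γ : Fin m → MvPolynomial (Fin (m - 1)) ℂ) (hΓ : ∀ i, (Γ i).totalDegree ≤ 2)
    (hsub : Set.range (fun x : ℂ => fun i : Fin m => x ^ expo m (2 * (i : ℕ) + 1) + x ^ expo m (2 * (i : ℕ) + 2)) ⊆
      Set.range (fun y : Fin (m - 1) → ℂ => fun i : Fin m => MvPolynomial.eval y (Γ i))) :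
    InftyStructure Γ := by
  have hmpos : 0 < m := by omega
  have hab : ∀ i : Fin m, expo m (2 * (i : ℕ) + 1) < expo m (2 * (i : ℕ) + 2) := fun i => hmono _
  obtain ⟨N, p, hN, hp⟩ := h₀ m (m - 1) _ _ Γ hmpos hΓ hsub
  obtain ⟨μ, hμ, hpμ, hz, hB⟩ := h₁ m (m - 1) _ _ Γ N p hmpos hΓ hN hab hp
  by_cases hτ : ∃ τ : Fin m, 2 * μ = -((N * expo m (2 * (τ : ℕ) + 2) : ℕ) : ℤ)
  · obtain ⟨τ, hτ⟩ := hτ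
    have hoff : ∀ i, i ≠ τ →
        MvPolynomial.eval (fun j => (p j).coeff μ) (MvPolynomial.homogeneousComponent 2 (Γ i)) = 0 := by
      intro i hi
      rcases (hB i).2 with h | h
      · exact h
      · exfalso
        refine hi (b_injective hm4 ?_)
        have h1 : ((N * expo m (2 * (i : ℕ) + 2) : ℕ) : ℤ) = ((N * expo m (2 * (τ : ℕ) + 2) : ℕ) : ℤ) := by
          linarith
        have h2 : N * expo m (2 * (i : ℕ) + 2) = N * expo m (2 * (τ : ℕ) + 2) := by exact_mod_cast h1
        exact Nat.eq_of_mul_eq_mul_left hN h2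
    obtain ⟨z', hz', i₁, hi₁⟩ :=
      h₂ m (m - 1) _ _ Γ N p μ τ hΓ hN hab (b_injective hm4) hp hμ hpμ hz hτ hoff (hdbl τ)
    exact ⟨fun j => (p j).coeff μ, hz, z', hz', Or.inr ⟨τ, hoff, i₁, hi₁⟩⟩
  · push Not at hτ
    have h0 : ∀ i, MvPolynomial.eval (fun j => (p j).coeff μ) (MvPolynomial.homogeneousComponent 2 (Γ i)) = 0 :=
      fun i => ((hB i).2).resolve_right (hτ i)
    rcases h₂m m (m - 1) _ _ Γ N p μ hmpos hΓ hN hab (b_injective hm4) hp hμ hpμ hz h0 with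
      ⟨z', hz', i₁, hi₁⟩ | hmin
    · exact ⟨fun j => (p j).coeff μ, hz, z', hz', Or.inl ⟨h0, i₁, hi₁⟩⟩
    · -- v7: the integral remainder is contradictory (dimension count)
      exfalso
      obtain ⟨A, r, hdeg, hinv, hne, hord⟩ := hIR m (m - 1) _ _ Γ N p μ hΓ hN hab hp hμ hpμ hz h0 hmin
      refine hLA m (m - 1) (fun j => (p j).coeff μ) A r
        (fun i => -((N * expo m (2 * (i : ℕ) + 2) : ℕ) : ℤ) - μ) (by omega) hz hdeg hinv ?_ hne hord
      intro i j hij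
      have h1 : ((N * expo m (2 * (i : ℕ) + 2) : ℕ) : ℤ) = ((N * expo m (2 * (j : ℕ) + 2) : ℕ) : ℤ) := by
        simp only at hij
        linarith
      have h2 : N * expo m (2 * (i : ℕ) + 2) = N * expo m (2 * (j : ℕ) + 2) := by exact_mod_cast h1
      exact b_injective hm4 (Nat.eq_of_mul_eq_mul_left hN h2)

/-- **The crux from the stubs** (composition; conclusion literally the route decl).  A containment gives a Laurent
solution at the place over `0` (`numericToPuiseux_proof`) and — new in v4 — the structure at infinity
(`inftyStructure_of_range`).  A polar solution at `0` forces a common zero of all quadratic parts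
(`polar_forces_commonZero`, landed) and the step-2 dichotomy (stub 0-polar-2m), whence a short relation (stub DEEP-POLAR);
an integral immersive one is impossible (stubs 1a + 1b), a cross-cap one too (stub 1c), and any other integral one
yields a short relation (stub DEEP-INTEGRAL); short relations are killed by `xData_noShortRelation`. -/
theorem BinomialCandidate_of :
    Stmt.stub_jetReduction → Stmt.stub_lowDegreeVanishing → Stmt.stub_crossCap → Stmt.stub_expoCongruence →
      Stmt.stub_infinityGlue → Stmt.stub_infinityCommonZero → Stmt.stub_infinityStepTwo →
      Stmt.stub_infinityStepTwoImproperMinors → Stmt.stub_infinityIntegralRemainderOrders →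
      Stmt.stub_affineOrdersDependent → Stmt.stub_polarStepTwoMinors → Stmt.stub_expoGrowth →
      Stmt.stub_shallowCorankOne → Stmt.stub_nondegenerateCorankTwo → Stmt.stub_integralDeep → Stmt.stub_polarDeep →
      Summit.ValiantsHypothesis.ValiantsHypothesis.Theses.BinomialElusive.BinomialCandidate := by
  intro h₁ h₁' h₁'' h₄ hg₀ hg₁ hg₂ hg₂m hgIR hgLA hp₂ h₅ hsh hnd h₂ h₃
  obtain ⟨m₂, hm₂⟩ := h₂
  obtain ⟨m₃, hm₃⟩ := h₃
  obtain ⟨m₄, hm₄⟩ := h₄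
  obtain ⟨m₅, hm₅⟩ := h₅
  refine ⟨max (max m₂ m₃) (max (max m₄ m₅) (2 ^ 15)), fun m hm Γ hΓ hsub => ?_⟩
  have hm₂m : m₂ ≤ m := le_trans (le_max_left _ _) (le_of_max_le_left hm)
  have hm₃m : m₃ ≤ m := le_trans (le_max_right _ _) (le_of_max_le_left hm)
  have hm₄m : m₄ ≤ m := le_trans (le_trans (le_max_left _ _) (le_max_left _ _)) (le_of_max_le_right hm)
  have hm₅m : m₅ ≤ m := le_trans (le_trans (le_max_right _ _) (le_max_left _ _)) (le_of_max_le_right hm)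
  have hm15 : 2 ^ 15 ≤ m := le_trans (le_max_right _ _) (le_of_max_le_right hm)
  have hm4 : 4 ≤ m := le_trans (by norm_num) hm15
  have hmpos : 0 < m := by omega
  -- Step 0 (new in v4): the structure at infinity, for free.
  have hinf : InftyStructure Γ :=
    inftyStructure_of_range hg₀ hg₁ hg₂ hg₂m hgIR hgLA hm4 (fun j => (hm₅ m hm₅m).1 j) (fun τ => (hm₅ m hm₅m).2 τ) Γ
      hΓ hsub
  -- Step 1 (NumericToPuiseux, proved support): a Laurent solution at the place over `x = 0`.
  obtain ⟨N, p, hN, hp⟩ := Summit.ValiantsHypothesis.Theorems.numericToPuiseux_proof m (m - 1)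
    (fun i : Fin m => expo m (2 * (i : ℕ) + 1)) (fun i : Fin m => expo m (2 * (i : ℕ) + 2)) Γ hmpos hsub
  by_cases hint : ∀ j, 0 ≤ (p j).order
  · -- E-family arithmetic facts (P1), (P2), positivity, used by stubs 1a/1b/1c
    have hM : ∀ j : ℕ, 1 ≤ j → j ≤ 2 * m → expo m j % (2 * m + 2) ^ (Nat.log 2 m ^ 2 + 1) = 1 :=
      fun j hj hj' => (hm₄ m hm₄m j j hj hj' hj hj').1
    have hlt : ∀ j j' : ℕ, 1 ≤ j → j ≤ 2 * m → 1 ≤ j' → j' ≤ 2 * m →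
        2 * expo m j < (2 * m + 2) ^ (Nat.log 2 m ^ 2 + 1) * expo m j' :=
      fun j j' hj hj' hk hk' => (hm₄ m hm₄m j j' hj hj' hk hk').2
    have hpos1 : ∀ j : ℕ, 1 ≤ j → j ≤ 2 * m → 1 ≤ expo m j := by
      intro j hj hj'
      by_contra h0
      have h00 : expo m j = 0 := by omega
      have := hM j hj hj'
      rw [h00, Nat.zero_mod] at this
      exact zero_ne_one this
    have hP1 : ∀ u v : Fin m → ℤ, ∑ i, (|u i| + |v i|) ≤ 4 →
        ∑ i, (u i * ((expo m (2 * (i : ℕ) + 1) : ℕ) : ℤ) + v i * ((expo m (2 * (i : ℕ) + 2) : ℕ) : ℤ)) = 0 →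
        (u, v) = 0 :=
      fun u v hlen hrel => xData_noShortRelation m u v (le_trans hlen (four_le_log_sq hm4)) hrel
    have hP2 : ∃ M' : ℕ, (∀ i : Fin m, expo m (2 * (i : ℕ) + 1) % M' = 1 ∧ expo m (2 * (i : ℕ) + 2) % M' = 1) ∧
        (∀ i j : Fin m, 2 * expo m (2 * (i : ℕ) + 1) < M' * expo m (2 * (j : ℕ) + 1) ∧
          2 * expo m (2 * (i : ℕ) + 1) < M' * expo m (2 * (j : ℕ) + 2) ∧
          2 * expo m (2 * (i : ℕ) + 2) < M' * expo m (2 * (j : ℕ) + 1) ∧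
          2 * expo m (2 * (i : ℕ) + 2) < M' * expo m (2 * (j : ℕ) + 2)) :=
      ⟨(2 * m + 2) ^ (Nat.log 2 m ^ 2 + 1),
        fun i => ⟨hM _ (by omega) (by omega), hM _ (by omega) (by omega)⟩,
        fun i j => ⟨hlt _ _ (by omega) (by omega) (by omega) (by omega),
          hlt _ _ (by omega) (by omega) (by omega) (by omega),
          hlt _ _ (by omega) (by omega) (by omega) (by omega),
          hlt _ _ (by omega) (by omega) (by omega) (by omega)⟩⟩
    by_cases himm : LinearIndependent ℂ (fun j : Fin (m - 1) => fun i : Fin m =>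
        MvPolynomial.eval (fun l => (p l).coeff 0) (MvPolynomial.pderiv j (Γ i)))
    · -- immersive integral: impossible outright (stubs 1a/1b with (P1) at length 4 and (P2) from stub 4)
      obtain ⟨i₀, ψ, G, hsupp, hconst, hG, hcong, hfin⟩ := h₁ m (by omega) _ _ Γ N p hΓ hN hint himm
        (fun i => ⟨hpos1 _ (by omega) (by omega), hpos1 _ (by omega) (by omega)⟩) hp
      exact hfin (h₁' m _ _ N hN hP1 hP2 i₀ ψ G hsupp hconst hG hcong)
    · -- non-immersive.  (P1) at length `2D` and (P2) with factor `D`, `D = h/2`, for the shallow stub.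
      set D : ℕ := Nat.log 2 m ^ 2 / 2 with hDdef
      have hL : 15 ≤ Nat.log 2 m := Nat.le_log_of_pow_le (by norm_num) hm15
      have hD2 : 2 ≤ D := by
        rw [hDdef]
        have : 15 * 15 ≤ Nat.log 2 m ^ 2 := by nlinarith
        omega
      have hDh : 2 * D ≤ Nat.log 2 m ^ 2 := by rw [hDdef]; omega
      have hDm : D * (Nat.log 2 m ^ 2 + 1) ≤ 2 * m + 2 := by
        have h1 : D * (Nat.log 2 m ^ 2 + 1) ≤ Nat.log 2 m ^ 4 := by
          have : D ≤ Nat.log 2 m ^ 2 / 2 := le_rfl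
          have h2 : 1 ≤ Nat.log 2 m ^ 2 := Nat.one_le_pow _ _ (by omega)
          calc D * (Nat.log 2 m ^ 2 + 1) ≤ (Nat.log 2 m ^ 2 / 2) * (2 * Nat.log 2 m ^ 2) :=
                Nat.mul_le_mul le_rfl (by omega)
            _ ≤ Nat.log 2 m ^ 2 * Nat.log 2 m ^ 2 := by
                rw [← mul_assoc]; exact Nat.mul_le_mul_right _ (Nat.div_mul_le_self _ 2)
            _ = Nat.log 2 m ^ 4 := by ring
        have h2 : Nat.log 2 m ^ 4 ≤ 2 ^ (Nat.log 2 m + 1) := pow_four_le_two_pow _ hL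
        have h3 : 2 ^ (Nat.log 2 m + 1) ≤ 2 * m + 2 := by
          rw [pow_succ]
          have := Nat.pow_log_le_self 2 (show m ≠ 0 by omega)
          omega
        omega
      have hP1D : ∀ u v : Fin m → ℤ, ∑ i, (|u i| + |v i|) ≤ 2 * (D : ℤ) →
          ∑ i, (u i * ((expo m (2 * (i : ℕ) + 1) : ℕ) : ℤ) + v i * ((expo m (2 * (i : ℕ) + 2) : ℕ) : ℤ)) = 0 →
          (u, v) = 0 :=
        fun u v hlen hrel => xData_noShortRelation m u v (le_trans hlen (by exact_mod_cast hDh)) hrel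
      have hltD : ∀ j j' : ℕ, 1 ≤ j → j ≤ 2 * m → 1 ≤ j' → j' ≤ 2 * m →
          D * expo m j < (2 * m + 2) ^ (Nat.log 2 m ^ 2 + 1) * expo m j' :=
        fun j j' hj hj' hk hk' =>
          Summit.ValiantsHypothesis.ValiantsHypothesis.Theorems.BinomialCandidateStubs.expoCongruence_deg
            m (by omega) D j j' hDm hj hj' hk hk'
      have hP2D : ∃ M' : ℕ, (∀ i : Fin m, expo m (2 * (i : ℕ) + 1) % M' = 1 ∧ expo m (2 * (i : ℕ) + 2) % M' = 1) ∧
          (∀ i j : Fin m, D * expo m (2 * (i : ℕ) + 1) < M' * expo m (2 * (j : ℕ) + 1) ∧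
            D * expo m (2 * (i : ℕ) + 1) < M' * expo m (2 * (j : ℕ) + 2) ∧
            D * expo m (2 * (i : ℕ) + 2) < M' * expo m (2 * (j : ℕ) + 1) ∧
            D * expo m (2 * (i : ℕ) + 2) < M' * expo m (2 * (j : ℕ) + 2)) :=
        ⟨(2 * m + 2) ^ (Nat.log 2 m ^ 2 + 1),
          fun i => ⟨hM _ (by omega) (by omega), hM _ (by omega) (by omega)⟩,
          fun i j => ⟨hltD _ _ (by omega) (by omega) (by omega) (by omega),
            hltD _ _ (by omega) (by omega) (by omega) (by omega),
            hltD _ _ (by omega) (by omega) (by omega) (by omega),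
            hltD _ _ (by omega) (by omega) (by omega) (by omega)⟩⟩
      -- a nonzero kernel vector
      obtain ⟨κ, hker, hκ⟩ : ∃ κ : Fin (m - 1) → ℂ,
          (∀ i, ∑ j, κ j * MvPolynomial.eval (fun l => (p l).coeff 0) (MvPolynomial.pderiv j (Γ i)) = 0) ∧ κ ≠ 0 := by
        rw [Fintype.not_linearIndependent_iff] at himm
        obtain ⟨g, hg, j, hj⟩ := himm
        refine ⟨g, fun i => ?_, fun h => hj (by rw [h]; rfl)⟩
        have := congr_fun hg i
        simpa [Finset.sum_apply, Pi.smul_apply, smul_eq_mul] using this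
      by_cases hone : ∀ κ' : Fin (m - 1) → ℂ,
          (∀ i, ∑ j, κ' j * MvPolynomial.eval (fun l => (p l).coeff 0) (MvPolynomial.pderiv j (Γ i)) = 0) →
          ∃ μ : ℂ, κ' = μ • κ
      · -- corank one: shallow ⇒ impossible (stub SHALLOW CORANK ONE); deep arc ⇒ stub DEEP-INTEGRAL
        by_cases hdeep : ∃ γ : Fin (m - 1) → Polynomial ℂ, (∀ j, (γ j).coeff 0 = (p j).coeff 0) ∧
            (∀ j, (γ j).coeff 1 = κ j) ∧ ∀ i, ∀ n ≤ Nat.log 2 m ^ 2 / 2, (MvPolynomial.aeval γ (Γ i)).coeff n = 0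
        · obtain ⟨u, v, huv, hlen, hrel⟩ := hm₂ m hm₂m _ _ Γ N p hΓ hN hint
            (Or.inr ⟨κ, hκ, hker, hone, hdeep⟩) hinf hp
          exact huv (xData_noShortRelation m u v hlen hrel)
        · exact hsh m (by omega) D _ _ Γ N p hΓ hN hint
            (fun i => ⟨hpos1 _ (by omega) (by omega), hpos1 _ (by omega) (by omega)⟩) hD2 hP1D hP2D κ hκ hker
            hone hdeep hp
      · -- corank at least two ⇒ stub DEEP-INTEGRAL
        push Not at hone
        obtain ⟨κ', hker', hκ'⟩ := hone
        have hind : ∀ c₁ c₂ : ℂ, c₁ • κ + c₂ • κ' = 0 → c₁ = 0 ∧ c₂ = 0 := by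
          intro c₁ c₂ h
          by_cases hc₂ : c₂ = 0
          · subst hc₂
            rw [zero_smul, add_zero] at h
            exact ⟨(smul_eq_zero.mp h).resolve_right hκ, rfl⟩
          · exfalso
            refine hκ' (-(c₁ / c₂)) ?_
            have h2 : c₂ • κ' = -(c₁ • κ) := eq_neg_of_add_eq_zero_right h
            calc κ' = c₂⁻¹ • (c₂ • κ') := by rw [smul_smul, inv_mul_cancel₀ hc₂, one_smul]
              _ = -(c₁ / c₂) • κ := by rw [h2, smul_neg, smul_smul, neg_smul, div_eq_inv_mul]
        by_cases hND : (∃ (κ₁ κ₂ : Fin (m - 1) → ℂ) (lam : Fin 3 → Fin m → ℂ),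
              (∀ i, ∑ j, κ₁ j * MvPolynomial.eval (fun l => (p l).coeff 0) (MvPolynomial.pderiv j (Γ i)) = 0) ∧
              (∀ i, ∑ j, κ₂ j * MvPolynomial.eval (fun l => (p l).coeff 0) (MvPolynomial.pderiv j (Γ i)) = 0) ∧
              (∀ c₁ c₂ : ℂ, c₁ • κ₁ + c₂ • κ₂ = 0 → c₁ = 0 ∧ c₂ = 0) ∧
              (∀ κ' : Fin (m - 1) → ℂ,
                (∀ i, ∑ j, κ' j * MvPolynomial.eval (fun l => (p l).coeff 0) (MvPolynomial.pderiv j (Γ i)) = 0) →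
                ∃ μ₁ μ₂ : ℂ, κ' = μ₁ • κ₁ + μ₂ • κ₂) ∧
              (∀ a : Fin 3, ∀ j : Fin (m - 1),
                ∑ i, lam a i * MvPolynomial.eval (fun l => (p l).coeff 0) (MvPolynomial.pderiv j (Γ i)) = 0) ∧
              (∀ c : Fin 3 → ℂ, (∀ i, ∑ a, c a * lam a i = 0) → c = 0) ∧
              (∀ x₁ x₂ : ℂ, (∀ a : Fin 3, ∑ i, lam a i *
                  MvPolynomial.eval (x₁ • κ₁ + x₂ • κ₂) (MvPolynomial.homogeneousComponent 2 (Γ i)) = 0) → x₁ = 0 ∧ x₂ = 0))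
        · -- nondegenerate corank two: impossible (stub NONDEGENERATE CORANK TWO)
          obtain ⟨κ₁, κ₂, lam, hk₁, hk₂, hind₂, hspan, hlam, hlamind, hnondeg⟩ := hND
          have hD8 : 8 ≤ D := by
            rw [hDdef]
            have : 15 * 15 ≤ Nat.log 2 m ^ 2 := by nlinarith
            omega
          exact hnd m (by omega) D _ _ Γ N p hΓ hN hint
            (fun i => ⟨hpos1 _ (by omega) (by omega), hpos1 _ (by omega) (by omega)⟩) hD8 hP1D hP2D κ₁ κ₂ lam
            hk₁ hk₂ hind₂ hspan hlam hlamind hnondeg hp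
        · obtain ⟨u, v, huv, hlen, hrel⟩ := hm₂ m hm₂m _ _ Γ N p hΓ hN hint
            (Or.inl ⟨⟨κ, κ', hker, hker', hind⟩, hND⟩) hinf hp
          exact huv (xData_noShortRelation m u v hlen hrel)
  · -- polar at the place over 0: least order `μ < 0`, common zero of ALL quadratic parts (landed), step 2 (stub),
    -- then stub DEEP-POLAR
    push Not at hint
    obtain ⟨j₀, hj₀⟩ := hint
    obtain ⟨j₁, -, hj₁⟩ :=
      Finset.exists_min_image Finset.univ (fun j => (p j).order) ⟨j₀, Finset.mem_univ _⟩
    set μ := (p j₁).order with hμdef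
    have hμ : μ < 0 := lt_of_le_of_lt (hj₁ j₀ (Finset.mem_univ _)) hj₀
    have hpμ : ∀ j, ∀ g < μ, (p j).coeff g = 0 := fun j g hg =>
      HahnSeries.coeff_eq_zero_of_lt_order (lt_of_lt_of_le hg (hj₁ j (Finset.mem_univ _)))
    have hz : (fun j => (p j).coeff μ) ≠ 0 := by
      intro h
      have h1 : p j₁ = 0 := HahnSeries.coeff_order_eq_zero.mp (congr_fun h j₁)
      have : μ = 0 := by rw [hμdef, h1, HahnSeries.order_zero]
      omega
    have hB0 : ∀ i, MvPolynomial.eval (fun j => (p j).coeff μ) (MvPolynomial.homogeneousComponent 2 (Γ i)) = 0 :=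
      fun i => Summit.ValiantsHypothesis.ValiantsHypothesis.Theorems.BinomialCandidateStubs.PolarPeeling.polar_forces_commonZero
        (Γ i) (hΓ i) p μ hμ hpμ (fun g hg => by
          rw [hp i]
          exact Summit.ValiantsHypothesis.ValiantsHypothesis.Theorems.BinomialCandidateStubs.PolarPeeling.coeff_binomial_eq_zero_of_neg
            N _ _ g hg)
    have hstep := hp₂ m (m - 1) _ _ Γ N p μ hΓ hN hp hμ hpμ hz hB0
    obtain ⟨u, v, huv, hlen, hrel⟩ := hm₃ m hm₃m _ _ Γ N p μ hΓ hN hμ hpμ hz hB0 hstep hinf hp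
    exact huv (xData_noShortRelation m u v hlen hrel)

/-- THE SKELETON: the crux, modulo exactly the registered stubs (compiler-checks that the `Stmt` copies and the
stub statements agree). -/
theorem BinomialCandidate_proof :
    Summit.ValiantsHypothesis.ValiantsHypothesis.Theses.BinomialElusive.BinomialCandidate :=
  BinomialCandidate_of stub_jetReduction stub_lowDegreeVanishing stub_crossCap stub_expoCongruence
    stub_infinityGlue stub_infinityCommonZero stub_infinityStepTwo stub_infinityStepTwoImproperMinors
    stub_infinityIntegralRemainderOrders stub_affineOrdersDependent stub_polarStepTwoMinors
    stub_expoGrowth stub_shallowCorankOne stub_nondegenerateCorankTwo stub_integralDeep stub_polarDeep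

end Summit.ValiantsHypothesis.ValiantsHypothesis.Cruxes.BinomialCandidate.Birth
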